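import Literature.MathematicalPhysics.QuantumLattice.ChargeTransportLocality
import Literature.MathematicalPhysics.QuantumLattice.ChargeIndexExactSymmetry
import HarnessLib

/-!
# The charge-transport index for a strict translation symmetry: Lieb–Schultz–Mattis via
# Bachmann–Bols–De Roeck–Fraas, Theorem 2.1 with Proposition 2.4, quantitatively

Generic layer (arbitrary finite graph `G` on a linearly ordered site type `Λ`, a coordinate function
`coord : Λ → ℤ/L` that is `1`-Lipschitz along bonds, a site bijection `f` raising the coordinate by
one and commuting with the Hubbard Hamiltonian `H = hamiltonianWith G t U μ`, degree bound `Δ`) of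
the Lieb–Schultz–Mattis case (§3.2, Example 2) of S. Bachmann, A. Bols, W. De Roeck, M. Fraas,
*A many-body index for quantum charge transport*, Comm. Math. Phys. **375** (2019) 1249 (BBDF).
All hypotheses are bundled in the `Prop`-valued structure `LSMSetting` (unique gapped ground state
`ψ`, `‖ψ‖ = 1`, window/strip radii `r + 2 ≤ m`, `2m + 2 ≤ h`, `h + 2m + 1 ≤ L`, and a separation
condition between the two strips). Everything is PROVED; no named fact is introduced.

* **The operators** (BBDF (4.5)–(4.6) with `Q = Q^σ_Γ`, `Γ` the slab over `[0, h)`, and the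
  strictly local quasi-adiabatic approximants `K_± = kLoc` of `ChargeTransportLocality`):
  `qBar = Q_Γ - K₋ - K₊`, `qBarM = Q_{[0,m]} - K₋`, `qMid = Q_{[m+1, h-m-2]}`,
  `qBarP = Q_{[h-1-m, h-1]} - K₊`, their translates `qBarMU = Q_{[1,m]} - VK₋Vᴴ`,
  `qBarPU = Q_{[h-1-m,h]} - VK₊Vᴴ` (`V = transV f = relabelOp (Orb.mapEquiv f)`), the
  decompositions `qBar_eq : Q̄ = Q̄₋ + Q_m + Q̄₊` and `transV_conj_qBar : VQ̄Vᴴ = Q̄₋^U + Q_m + Q̄₊^U`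
  (exact: `VQ_ΓVᴴ - Q_Γ = -Q_{[0]} + Q_{[h]}`, BBDF §3.2), supports and commutation.
* **BBDF Lemma 4.4 quantitatively** (`eucNorm_qBar_sub_le`): `‖(Q̄ - q̄)ψ‖₂ ≤ 2δ_K`,
  `δ_K = ‖K₋ - K̃₋‖ + ‖K₊ - K̃₊‖`, because `ψ` is an EXACT eigenvector of `Q - K̃₋ - K̃₊`.
* **Assumption (v) between the strips** (`strip_clustering`, constant `clustK`), from
  `coord_clustering`.
* **`⟨D₋⟩ = -⟨Q_{[0]}⟩`** for `D₋ = Q̄₋^U - Q̄₋` (`expect_dM`, BBDF (4.14)) and the support identity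
  `V e^{2πiQ̄₋} Vᴴ = e^{2πiQ̄₋^U}` (`transV_conj_exp_two_pi_qBarM`, BBDF §4.4).
* **The index theorem** `exists_int_abs_expect_plane_sub_le`: feeding the above into the abstract
  exact-symmetry index theorem `exists_int_abs_expect_sub_le_of_exact_symmetry`
  (`ChargeIndexExactSymmetry`, BBDF §4) gives
  `dist(⟨ψ, Q^σ_{[0]}ψ⟩, ℤ) ≤ (2π(16πδ_K + clustK)‖D₋‖ + 2√(8πδ_K + 2clustK) + 8πδ_K + 2clustK)/4`.
* **The `O(L^{-k})` bookkeeping** (BBDF: "`+ O(L^{-∞})`") in the regime `h = L/2`, `m = L/8`,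
  `r = L/16`, `L ≥ lsmL0 = 128(⌈κ⌉₊+1)` (`LSMSetting.of_regime`): `δ_K ≤ 2·dK1Const/L^q`
  (Lieb–Robinson + filter tail, `norm_kLoc_sub_kTilde_le_of_regime`), `clustK ≤ clustKConst/L^q`,
  `‖D₋‖ ≤ dmConst·L^d` when `|Λ| ≤ L^d`, whence
  `exists_int_abs_expect_plane_sub_le_of_regime : dist(⟨ψ, Q^σ_{[0]}ψ⟩, ℤ) ≤ lsmConst/L^k` with an
  explicit constant `lsmConst Δ d t U μ γ g k` independent of `Λ` and `L`.

The Hubbard torus `ℤ_L^d` is an instance (`HubbardLSMFillingHolds`), which proves the named fact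
`bbdf2019_lsm_filling_hubbardTorus`.

## References

* S. Bachmann, A. Bols, W. De Roeck, M. Fraas, Comm. Math. Phys. **375** (2019) 1249–1272,
  arXiv:1810.07351: Theorem 2.1, Proposition 2.4, §3.2 (Example 2), §4 (eqs. (4.5)–(4.6),
  Lemma 4.4, (4.13)–(4.15), §4.4). [BachmannEtAl2019]
* The tree: `ChargeTransportLocality` (`kLoc`, `kTilde`, `norm_kLoc_sub_kTilde_le`,
  `setCharge_sub_kTilde_mulVec`, `coord_clustering`), `ChargeIndexExactSymmetry`
  (`exists_int_abs_expect_sub_le_of_exact_symmetry`), `CoordinateSlabs`, `HubbardTorusCharges`,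
  `ApproximateEigenvectorLemmas`, `QuasiAdiabaticGenerator`.
-/

noncomputable section

namespace Literature.MathematicalPhysics.QuantumLattice

open Matrix Complex Finset HubbardWave0
open scoped Matrix.Norms.L2Operator ComplexOrder

section ZRangeExtras

variable {L : ℕ}

/-- Periodicity of cyclic intervals. [folklore] -/
theorem zrange_add_period (a n : ℕ) : (zrange (a + L) n : Finset (ZMod L)) = zrange a n := by
  ext x
  simp only [mem_zrange]
  constructor
  · rintro ⟨k, hk, rfl⟩; exact ⟨k, hk, by push_cast; simp⟩
  · rintro ⟨k, hk, rfl⟩; exact ⟨k, hk, by push_cast; simp⟩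

/-- Inclusion of cyclic intervals from inclusion of the integer ranges. [folklore] -/
theorem zrange_subset_zrange {a n b n' : ℕ} (h1 : b ≤ a) (h2 : a + n ≤ b + n') :
    (zrange a n : Finset (ZMod L)) ⊆ zrange b n' := by
  intro x hx
  obtain ⟨k, hk, rfl⟩ := mem_zrange.1 hx
  exact mem_zrange.2 ⟨a - b + k, by omega, by congr 1; omega⟩

variable [NeZero L]

/-- **Separation of two cyclic intervals**: for `x ∈ [a, a+n)`, `y ∈ [b, b+n')` with
`a + n ≤ b` and `b + n' ≤ a + L`, `circDist x y ≥ min (b + 1 - (a+n)) (a + L + 1 - (b+n'))`.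
[folklore] -/
theorem le_circDist_of_mem_zrange {a n b n' : ℕ} (hab : a + n ≤ b) (hba : b + n' ≤ a + L)
    {x y : ZMod L} (hx : x ∈ zrange a n) (hy : y ∈ zrange b n') :
    min (b + 1 - (a + n)) (a + L + 1 - (b + n')) ≤ circDist x y := by
  obtain ⟨i, hi, rfl⟩ := mem_zrange.1 hx
  obtain ⟨j, hj, rfl⟩ := mem_zrange.1 hy
  set v : ℕ := b + j - (a + i) with hv
  have hv1 : 1 ≤ v := by omega
  have hvL : v < L := by omega
  have hdiff : ((b + j : ℕ) : ZMod L) - ((a + i : ℕ) : ZMod L) = ((v : ℕ) : ZMod L) := by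
    rw [hv, Nat.cast_sub (by omega)]
  have hval1 : (((b + j : ℕ) : ZMod L) - ((a + i : ℕ) : ZMod L)).val = v := by
    rw [hdiff, ZMod.val_natCast, Nat.mod_eq_of_lt hvL]
  have hne : ((v : ℕ) : ZMod L) ≠ 0 := by
    intro h0
    rw [ZMod.natCast_eq_zero_iff] at h0
    exact absurd (Nat.le_of_dvd (by omega) h0) (by omega)
  haveI : NeZero ((v : ℕ) : ZMod L) := ⟨hne⟩
  have hval2 : (((a + i : ℕ) : ZMod L) - ((b + j : ℕ) : ZMod L)).val = L - v := by
    rw [← neg_sub, hdiff, ZMod.val_neg_of_ne_zero, ZMod.val_natCast, Nat.mod_eq_of_lt hvL]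
  unfold circDist
  rw [hval2, hval1]
  omega

end ZRangeExtras

section IndexSetting

variable {Λ : Type*} [LinearOrder Λ] [Fintype Λ] (G : SimpleGraph Λ) [DecidableRel G.Adj]
variable {L : ℕ} [NeZero L] (coord : Λ → ZMod L) (f : Λ ≃ Λ)
variable (t U μ γ : ℝ) (σ : Fin 2) (h m r : ℕ)

/-- **The data and hypotheses of the Lieb–Schultz–Mattis index argument** (BBDF §4 with the
unitary `U` = the unit translation, §3.2): a coordinate function and a unit translation that is a
symmetry of `H = H(t,U) - μN`, a degree bound, a spectral gap `g ≥ γ > 0` with unique ground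
state `ψ` (normalised), the scales `r < m < h/2` of the windows/balls/strips with
`h + 2m + 1 ≤ L` (for the torus `h = L/2`, `m = ⌊L/8⌋`, `r = ⌊L/16⌋`; BBDF §2.1.1), and the
separation of the two strips `S_±` beyond the Lieb–Robinson horizon (`sep`, a largeness
condition on `L`).
[cite: BachmannEtAl2019, §2.1.1 and §4] -/
structure LSMSetting (Δ : ℕ) (g : ℝ) (ψ : Fock (Orb Λ)) [NeZero L] : Prop where
  coordFn : IsCoordFn coord G
  shift : ∀ x, coord (f x) = coord x + 1
  degree : ∀ x : Λ, (Finset.univ.filter fun y => G.Adj x y).card ≤ Δ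
  surj : ∀ a : ZMod L, ∃ x, coord x = a
  symm : relabelOp (Orb.mapEquiv f) * hamiltonianWith G t U μ = hamiltonianWith G t U μ * relabelOp (Orb.mapEquiv f)
  gamma_pos : 0 < γ
  gamma_le : γ ≤ g
  gap : (hamiltonianWith G t U μ).HasSpectralGap g
  ground : (hamiltonianWith G t U μ).IsGroundStateVector ψ
  unit : star ψ ⬝ᵥ ψ = 1
  four_le_r : 4 ≤ r
  r_add_two_le : r + 2 ≤ m
  two_m_add_two_le : 2 * m + 2 ≤ h
  h_le : h + 2 * m + 1 ≤ L
  sep : max (2 * (lrRate Δ t U μ + 1)) 1 ≤ ((min (L - h - 2 * m) (h - 1 - 2 * m) : ℕ) : ℝ) - 1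

/-! #### The operators -/

/-- The translation unitary `V = Γ_{Orb.mapEquiv f}` (BBDF's `U⋆` acts as `V · Vᴴ`). [folklore] -/
def transV : Matrix (Finset (Orb Λ)) (Finset (Orb Λ)) ℂ := relabelOp (Orb.mapEquiv f)

/-- `K₋ = i𝓘^{H_{B₋}}(J₋)`, `J₋ = J(Γ, {-1,0})`, `B₋ = [-r, r]`. [cite: BachmannEtAl2019, Proposition 2.4] -/
def kM : Matrix (Finset (Orb Λ)) (Finset (Orb Λ)) ℂ :=
  kLoc G coord t U μ γ σ (zrange 0 h) (zrange (L - 1) 2) (zrange (L - r) (2 * r + 1))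

/-- `K₊ = i𝓘^{H_{B₊}}(J₊)`, `J₊ = J(Γ, {h-1,h})`, `B₊ = [h-1-r, h+r]`. [cite: BachmannEtAl2019, Proposition 2.4] -/
def kP : Matrix (Finset (Orb Λ)) (Finset (Orb Λ)) ℂ :=
  kLoc G coord t U μ γ σ (zrange 0 h) (zrange (h - 1) 2) (zrange (h - 1 - r) (2 * r + 2))

/-- `K̃₋ = i𝓘^{H}(J₋)`. [cite: BachmannEtAl2019, Proposition 2.4] -/
def kTM : Matrix (Finset (Orb Λ)) (Finset (Orb Λ)) ℂ := kTilde G coord t U μ γ σ (zrange 0 h) (zrange (L - 1) 2)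

/-- `K̃₊ = i𝓘^{H}(J₊)`. [cite: BachmannEtAl2019, Proposition 2.4] -/
def kTP : Matrix (Finset (Orb Λ)) (Finset (Orb Λ)) ℂ := kTilde G coord t U μ γ σ (zrange 0 h) (zrange (h - 1) 2)

/-- `Q̄ = Q_Γ - K₋ - K₊` (BBDF Lemma 4.4). [cite: BachmannEtAl2019, Lemma 4.4] -/
def qBar : Matrix (Finset (Orb Λ)) (Finset (Orb Λ)) ℂ :=
  setCharge σ (cslab coord (zrange 0 h)) - kM G coord t U μ γ σ h r - kP G coord t U μ γ σ h r

/-- `Q̄₋ = Q_{[0,m]} - K₋` (BBDF (4.5)). [cite: BachmannEtAl2019, Eq. (4.5)] -/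
def qBarM : Matrix (Finset (Orb Λ)) (Finset (Orb Λ)) ℂ :=
  setCharge σ (cslab coord (zrange 0 (m + 1))) - kM G coord t U μ γ σ h r

/-- `Q_m = Q_{[m+1, h-m-2]}` (BBDF (2.8)/(4.5)). [cite: BachmannEtAl2019, Eq. (4.5)] -/
def qMid : Matrix (Finset (Orb Λ)) (Finset (Orb Λ)) ℂ :=
  setCharge σ (cslab coord (zrange (m + 1) (h - 2 * m - 2)))

/-- `Q̄₊ = Q_{[h-1-m, h-1]} - K₊` (BBDF (4.5)). [cite: BachmannEtAl2019, Eq. (4.5)] -/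
def qBarP : Matrix (Finset (Orb Λ)) (Finset (Orb Λ)) ℂ :=
  setCharge σ (cslab coord (zrange (h - 1 - m) (m + 1))) - kP G coord t U μ γ σ h r

/-- `Q̄₋^U = Q_{[1,m]} - V K₋ Vᴴ` (BBDF (4.6) with `T₋ = -Q_{[0]}`). [cite: BachmannEtAl2019, Eq. (4.6)] -/
def qBarMU : Matrix (Finset (Orb Λ)) (Finset (Orb Λ)) ℂ :=
  setCharge σ (cslab coord (zrange 1 m)) - transV f * kM G coord t U μ γ σ h r * (transV f)ᴴ

/-- `Q̄₊^U = Q_{[h-1-m, h]} - V K₊ Vᴴ` (BBDF (4.6) with `T₊ = Q_{[h]}`). [cite: BachmannEtAl2019, Eq. (4.6)] -/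
def qBarPU : Matrix (Finset (Orb Λ)) (Finset (Orb Λ)) ℂ :=
  setCharge σ (cslab coord (zrange (h - 1 - m) (m + 2))) - transV f * kP G coord t U μ γ σ h r * (transV f)ᴴ


/-! #### Geometry of the intervals -/

section Geometry

variable {G coord f t U μ γ h m r} {Δ : ℕ} {g : ℝ} {ψ : Fock (Orb Λ)}

omit [NeZero L] in
/-- Membership in a shifted interval. [folklore] -/
theorem mem_zrange_add_iff_sub_mem {L : ℕ} (c a n : ℕ) (x : ZMod L) :
    x ∈ (zrange (c + a) n : Finset (ZMod L)) ↔ x - (c : ℕ) ∈ (zrange a n : Finset (ZMod L)) := by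
  simp only [mem_zrange]
  constructor
  · rintro ⟨k, hk, rfl⟩; exact ⟨k, hk, by push_cast; ring⟩
  · rintro ⟨k, hk, hx⟩
    refine ⟨k, hk, ?_⟩
    have := congrArg (fun z => z + ((c : ℕ) : ZMod L)) hx
    simp only [sub_add_cancel] at this
    rw [this]; push_cast; ring

/-- **Outside the ball of radius `r` around `c`, the periodic distance to `c` is `> r`**:
`a ∉ [c-r, c+r] ⟹ circDist a c ≥ r + 1` (`2r + 1 ≤ L`). [folklore] -/
theorem le_circDist_of_not_mem_ball {c r : ℕ} (hr : 2 * r + 1 ≤ L) {a : ZMod L}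
    (ha : a ∉ (zrange (c + (L - r)) (2 * r + 1) : Finset (ZMod L))) : r + 1 ≤ circDist a (c : ℕ) := by
  rw [mem_zrange_add_iff_sub_mem] at ha
  set b : ZMod L := a - (c : ℕ) with hb
  have hbval : b = ((b.val : ℕ) : ZMod L) := (ZMod.natCast_zmod_val b).symm
  have hlow : r + 1 ≤ b.val := by
    by_contra hlt
    apply ha
    refine mem_zrange.2 ⟨r + b.val, by omega, ?_⟩
    rw [show L - r + (r + b.val) = L + b.val by omega]
    push_cast
    rw [ZMod.natCast_self, zero_add]
    exact hbval
  have hhigh : b.val ≤ L - r - 1 := by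
    by_contra hlt
    apply ha
    have hvL : b.val < L := ZMod.val_lt b
    refine mem_zrange.2 ⟨b.val - (L - r), by omega, ?_⟩
    rw [show L - r + (b.val - (L - r)) = b.val by omega]
    exact hbval
  have hne : b ≠ 0 := by
    intro h0; rw [h0, ZMod.val_zero] at hlow; omega
  haveI : NeZero b := ⟨hne⟩
  have e1 : circDist a (c : ℕ) = min b.val (L - b.val) := by
    unfold circDist
    rw [← hb, show ((c : ℕ) : ZMod L) - a = -b by rw [hb]; ring, ZMod.val_neg_of_ne_zero]
  rw [e1]
  exact le_min hlow (by omega)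

/-- The periodic distance is `1`-Lipschitz in the second argument under `b ↦ b - 1`. [folklore] -/
theorem circDist_le_circDist_sub_one_add_one (a b : ZMod L) : circDist a b ≤ circDist a (b - 1) + 1 := by
  rw [circDist_comm a b, circDist_comm a (b - 1)]
  have := circDist_add_one_le (b - 1) a
  rwa [sub_add_cancel] at this

omit [DecidableRel G.Adj] in
/-- **Terms not inside the ball `B₋ = [-r, r]` keep `x₁`-distance `≥ r - 1` from the window
`{-1, 0}`** (the hypothesis `hR` of `norm_kLoc_sub_kTilde_le` for `K₋`). [folklore] -/
theorem ballM_separation (hc : IsCoordFn coord G) (hr : 2 * r + 1 ≤ L) (hr1 : 1 ≤ r) :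
    ∀ Z : HubbardIdx G, ¬ hubbardTermSupp G Z ⊆ cslab coord (zrange (L - r) (2 * r + 1)) →
      ∀ z ∈ hubbardTermSupp G Z, ∀ p ∈ cslab coord (zrange (L - 1) 2), r - 1 ≤ circDist (coord z) (coord p) := by
  intro Z hZ z hz p hp
  obtain ⟨w, hwZ, hw⟩ := Finset.not_subset.1 hZ
  rw [mem_cslab] at hw hp
  -- distance from `coord w` to `0` is `≥ r + 1`, to `-1` is `≥ r`
  have h0 : r + 1 ≤ circDist (coord w) ((0 : ℕ) : ZMod L) :=
    le_circDist_of_not_mem_ball (c := 0) hr (by rwa [zero_add])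
  have hm1 : r ≤ circDist (coord w) (-1) := by
    have := circDist_le_circDist_sub_one_add_one (coord w) 0
    rw [Nat.cast_zero] at h0
    rw [zero_sub] at this
    omega
  -- `coord p ∈ {-1, 0}`
  obtain ⟨j, hj, hpj⟩ := mem_zrange.1 hp
  have hp' : coord p = -1 ∨ coord p = 0 := by
    interval_cases j
    · left; rw [hpj, add_zero, natCast_pred_eq_neg_one]
    · right; rw [hpj, show L - 1 + 1 = L by omega, ZMod.natCast_self]
  have hwp : r ≤ circDist (coord w) (coord p) := by
    rcases hp' with e | e
    · rw [e]; exact hm1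
    · rw [e]; rw [Nat.cast_zero] at h0; omega
  -- `z = w` or adjacent: lose at most one
  rcases eq_or_adj_of_mem_hubbardTermSupp G hz hwZ with rfl | hadj
  · omega
  · rcases hc z w hadj with e | e | e
    · rw [e]; omega
    · have := circDist_add_one_le (coord z) (coord p)
      rw [← e] at this; omega
    · have := circDist_le_circDist_add_one (coord w) (coord p)
      rw [← e] at this; omega

omit [DecidableRel G.Adj] in
/-- **Terms not inside the ball `B₊ = [h-1-r, h+r]` keep `x₁`-distance `≥ r - 1` from the window
`{h-1, h}`.** [folklore] -/
theorem ballP_separation (hc : IsCoordFn coord G) (hr : 2 * r + 1 ≤ L) (hr1 : 1 ≤ r) (hh : r + 1 ≤ h) :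
    ∀ Z : HubbardIdx G, ¬ hubbardTermSupp G Z ⊆ cslab coord (zrange (h - 1 - r) (2 * r + 2)) →
      ∀ z ∈ hubbardTermSupp G Z, ∀ p ∈ cslab coord (zrange (h - 1) 2), r - 1 ≤ circDist (coord z) (coord p) := by
  intro Z hZ z hz p hp
  obtain ⟨w, hwZ, hw⟩ := Finset.not_subset.1 hZ
  rw [mem_cslab] at hw hp
  -- the ball around `h - 1` and the ball around `h` are both inside `B₊`
  have hsub1 : (zrange (h - 1 + (L - r)) (2 * r + 1) : Finset (ZMod L)) ⊆ zrange (h - 1 - r) (2 * r + 2) := by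
    rw [show h - 1 + (L - r) = (h - 1 - r) + L by omega, zrange_add_period]
    exact zrange_subset_zrange le_rfl (by omega)
  have hsub2 : (zrange (h + (L - r)) (2 * r + 1) : Finset (ZMod L)) ⊆ zrange (h - 1 - r) (2 * r + 2) := by
    rw [show h + (L - r) = (h - r) + L by omega, zrange_add_period]
    exact zrange_subset_zrange (by omega) (by omega)
  have h1 : r + 1 ≤ circDist (coord w) ((h - 1 : ℕ) : ZMod L) :=
    le_circDist_of_not_mem_ball hr (fun hmem => hw (hsub1 hmem))
  have h2 : r + 1 ≤ circDist (coord w) ((h : ℕ) : ZMod L) :=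
    le_circDist_of_not_mem_ball hr (fun hmem => hw (hsub2 hmem))
  obtain ⟨j, hj, hpj⟩ := mem_zrange.1 hp
  have hwp : r + 1 ≤ circDist (coord w) (coord p) := by
    interval_cases j
    · rw [hpj, add_zero]; exact h1
    · rw [hpj, show h - 1 + 1 = h by omega]; exact h2
  rcases eq_or_adj_of_mem_hubbardTermSupp G hz hwZ with rfl | hadj
  · omega
  · rcases hc z w hadj with e | e | e
    · rw [e]; omega
    · have := circDist_add_one_le (coord z) (coord p)
      rw [← e] at this; omega
    · have := circDist_le_circDist_add_one (coord w) (coord p)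
      rw [← e] at this; omega

end Geometry


/-! #### Supports of the operators and their commutation -/

section Supports

variable {G coord f t U μ γ σ h m r} {Δ : ℕ} {g : ℝ} {ψ : Fock (Orb Λ)}

local notation "𝔖" => LSMSetting G coord f t U μ γ h m r Δ g ψ

omit [NeZero L] in
/-- Even elements of the CAR algebras of slabs over disjoint coordinate sets commute. [folklore] -/
theorem commute_of_mem_cslab {S T : Finset (ZMod L)} {A B : Matrix (Finset (Orb Λ)) (Finset (Orb Λ)) ℂ}
    (hA : A ∈ carEvenSubalgebra (orbSet (cslab coord S))) (hB : B ∈ carEvenSubalgebra (orbSet (cslab coord T)))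
    (hST : Disjoint S T) : Commute A B :=
  commute_of_mem_carEvenSubalgebra hA ((carEvenSubalgebra_le_carSubalgebra _) hB)
    (disjoint_orbSet (disjoint_cslab coord hST))

omit [NeZero L] in
/-- Monotonicity of slab algebras in the coordinate set. [folklore] -/
theorem mem_of_subset {S T : Finset (ZMod L)} {A : Matrix (Finset (Orb Λ)) (Finset (Orb Λ)) ℂ}
    (hA : A ∈ carEvenSubalgebra (orbSet (cslab coord S))) (hST : S ⊆ T) :
    A ∈ carEvenSubalgebra (orbSet (cslab coord T)) :=
  carEvenSubalgebra_mono (orbSet_mono (cslab_mono coord hST)) hA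

/-- `K₋ ∈ 𝔄⁺(slab B₋)`. [folklore] -/
theorem kM_mem (hs : 𝔖) : kM G coord t U μ γ σ h r ∈ carEvenSubalgebra (orbSet (cslab coord (zrange (L - r) (2 * r + 1)))) := by
  have := hs.four_le_r
  exact kLoc_mem G coord t U μ γ σ (zrange_subset_zrange (by omega) (by omega))

/-- `K₊ ∈ 𝔄⁺(slab B₊)`. [folklore] -/
theorem kP_mem (hs : 𝔖) : kP G coord t U μ γ σ h r ∈ carEvenSubalgebra (orbSet (cslab coord (zrange (h - 1 - r) (2 * r + 2)))) := by
  have := hs.four_le_r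
  exact kLoc_mem G coord t U μ γ σ (zrange_subset_zrange (by omega) (by omega))

/-- `B₋ ⊆ S₋`. [folklore] -/
theorem ballM_subset_stripM (hs : 𝔖) : (zrange (L - r) (2 * r + 1) : Finset (ZMod L)) ⊆ zrange (L - m) (2 * m + 1) := by
  have := hs.r_add_two_le; have := hs.h_le; have := hs.two_m_add_two_le
  exact zrange_subset_zrange (by omega) (by omega)

/-- `B₋ + 1 ⊆ S₋`. [folklore] -/
theorem ballM_add_one_subset_stripM (hs : 𝔖) :
    ((zrange (L - r) (2 * r + 1) : Finset (ZMod L)).image fun a => a + 1) ⊆ zrange (L - m) (2 * m + 1) := by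
  have := hs.r_add_two_le; have := hs.h_le; have := hs.two_m_add_two_le
  rw [image_add_one_zrange]
  exact zrange_subset_zrange (by omega) (by omega)

/-- `B₊ ⊆ S₊`. [folklore] -/
theorem ballP_subset_stripP (hs : 𝔖) : (zrange (h - 1 - r) (2 * r + 2) : Finset (ZMod L)) ⊆ zrange (h - 1 - m) (2 * m + 2) := by
  have := hs.r_add_two_le; have := hs.two_m_add_two_le
  exact zrange_subset_zrange (by omega) (by omega)

/-- `B₊ + 1 ⊆ S₊`. [folklore] -/
theorem ballP_add_one_subset_stripP (hs : 𝔖) :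
    ((zrange (h - 1 - r) (2 * r + 2) : Finset (ZMod L)).image fun a => a + 1) ⊆ zrange (h - 1 - m) (2 * m + 2) := by
  have := hs.r_add_two_le; have := hs.two_m_add_two_le
  rw [image_add_one_zrange]
  exact zrange_subset_zrange (by omega) (by omega)

/-- `[0, m] ⊆ S₋` (through `[L, L+m]`). [folklore] -/
theorem zrange_zero_subset_stripM (hs : 𝔖) : (zrange 0 (m + 1) : Finset (ZMod L)) ⊆ zrange (L - m) (2 * m + 1) := by
  have := hs.h_le; have := hs.two_m_add_two_le
  rw [← zrange_add_period 0 (m + 1)]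
  exact zrange_subset_zrange (by omega) (by omega)

/-- `[1, m] ⊆ S₋`. [folklore] -/
theorem zrange_one_subset_stripM (hs : 𝔖) : (zrange 1 m : Finset (ZMod L)) ⊆ zrange (L - m) (2 * m + 1) := by
  have := hs.h_le; have := hs.two_m_add_two_le
  rw [← zrange_add_period 1 m]
  exact zrange_subset_zrange (by omega) (by omega)

/-- `Q̄₋ ∈ 𝔄⁺(slab S₋)`. [folklore] -/
theorem qBarM_mem (hs : 𝔖) : qBarM G coord t U μ γ σ h m r ∈ carEvenSubalgebra (orbSet (cslab coord (zrange (L - m) (2 * m + 1)))) :=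
  Subalgebra.sub_mem _ (mem_of_subset (setCharge_mem_carEvenSubalgebra σ _) (zrange_zero_subset_stripM hs))
    (mem_of_subset (kM_mem hs) (ballM_subset_stripM hs))

omit [NeZero L] in
/-- `Q_m ∈ 𝔄⁺(slab [m+1, h-m-2])`. [folklore] -/
theorem qMid_mem : qMid coord σ h m ∈ carEvenSubalgebra (orbSet (cslab coord (zrange (m + 1) (h - 2 * m - 2)))) :=
  setCharge_mem_carEvenSubalgebra σ _

/-- `Q̄₊ ∈ 𝔄⁺(slab S₊)`. [folklore] -/
theorem qBarP_mem (hs : 𝔖) : qBarP G coord t U μ γ σ h m r ∈ carEvenSubalgebra (orbSet (cslab coord (zrange (h - 1 - m) (2 * m + 2)))) :=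
  Subalgebra.sub_mem _ (mem_of_subset (setCharge_mem_carEvenSubalgebra σ _) (zrange_subset_zrange le_rfl (by omega)))
    (mem_of_subset (kP_mem hs) (ballP_subset_stripP hs))

/-- `V K₋ Vᴴ ∈ 𝔄⁺(slab (B₋ + 1))`. [folklore] -/
theorem transV_kM_mem (hs : 𝔖) : transV f * kM G coord t U μ γ σ h r * (transV f)ᴴ ∈
    carEvenSubalgebra (orbSet (cslab coord ((zrange (L - r) (2 * r + 1)).image fun a => a + 1))) :=
  relabelOp_conj_mem_carEvenSubalgebra_cslab hs.shift (kM_mem hs)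

/-- `V K₊ Vᴴ ∈ 𝔄⁺(slab (B₊ + 1))`. [folklore] -/
theorem transV_kP_mem (hs : 𝔖) : transV f * kP G coord t U μ γ σ h r * (transV f)ᴴ ∈
    carEvenSubalgebra (orbSet (cslab coord ((zrange (h - 1 - r) (2 * r + 2)).image fun a => a + 1))) :=
  relabelOp_conj_mem_carEvenSubalgebra_cslab hs.shift (kP_mem hs)

/-- `Q̄₋^U ∈ 𝔄⁺(slab S₋)`. [folklore] -/
theorem qBarMU_mem (hs : 𝔖) : qBarMU G coord f t U μ γ σ h m r ∈ carEvenSubalgebra (orbSet (cslab coord (zrange (L - m) (2 * m + 1)))) :=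
  Subalgebra.sub_mem _ (mem_of_subset (setCharge_mem_carEvenSubalgebra σ _) (zrange_one_subset_stripM hs))
    (mem_of_subset (transV_kM_mem hs) (ballM_add_one_subset_stripM hs))

/-- `Q̄₊^U ∈ 𝔄⁺(slab S₊)`. [folklore] -/
theorem qBarPU_mem (hs : 𝔖) : qBarPU G coord f t U μ γ σ h m r ∈ carEvenSubalgebra (orbSet (cslab coord (zrange (h - 1 - m) (2 * m + 2)))) :=
  Subalgebra.sub_mem _ (mem_of_subset (setCharge_mem_carEvenSubalgebra σ _) (zrange_subset_zrange le_rfl (by omega)))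
    (mem_of_subset (transV_kP_mem hs) (ballP_add_one_subset_stripP hs))

/-- `S₋ ∩ [m+1, h-m-2] = ∅`. [folklore] -/
theorem disjoint_stripM_mid (hs : 𝔖) : Disjoint (zrange (L - m) (2 * m + 1) : Finset (ZMod L)) (zrange (m + 1) (h - 2 * m - 2)) := by
  have := hs.h_le; have := hs.two_m_add_two_le
  rw [← zrange_add_period (m + 1)]
  exact disjoint_zrange_of_le (by omega) (by omega)

/-- `[m+1, h-m-2] ∩ S₊ = ∅`. [folklore] -/
theorem disjoint_mid_stripP (hs : 𝔖) : Disjoint (zrange (m + 1) (h - 2 * m - 2) : Finset (ZMod L)) (zrange (h - 1 - m) (2 * m + 2)) := by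
  have := hs.h_le; have := hs.two_m_add_two_le
  exact disjoint_zrange_of_le (by omega) (by omega)

/-- `S₊ ∩ S₋ = ∅`. [folklore] -/
theorem disjoint_stripP_stripM (hs : 𝔖) : Disjoint (zrange (h - 1 - m) (2 * m + 2) : Finset (ZMod L)) (zrange (L - m) (2 * m + 1)) := by
  have := hs.h_le; have := hs.two_m_add_two_le
  exact disjoint_zrange_of_le (by omega) (by omega)

end Supports


/-! #### The decompositions `Q̄ = Q̄₋ + Q_m + Q̄₊` and `V Q̄ Vᴴ = Q̄₋^U + Q_m + Q̄₊^U` -/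

section Identities

variable {G coord f t U μ γ σ h m r} {Δ : ℕ} {g : ℝ} {ψ : Fock (Orb Λ)}

local notation "𝔖" => LSMSetting G coord f t U μ γ h m r Δ g ψ

omit [NeZero L] in
/-- Charges of slabs over disjoint coordinate sets add. [folklore] -/
theorem setCharge_cslab_union {S T : Finset (ZMod L)} (hST : Disjoint S T) :
    setCharge σ (cslab coord (S ∪ T)) = setCharge σ (cslab coord S) + setCharge σ (cslab coord T) := by
  rw [cslab_union, setCharge_union (disjoint_cslab coord hST)]

/-- **BBDF (4.5)**: `Q̄ = Q̄₋ + Q_m + Q̄₊`. [cite: BachmannEtAl2019, Eq. (4.5)] -/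
theorem qBar_eq (hs : 𝔖) : qBar G coord t U μ γ σ h r =
    qBarM G coord t U μ γ σ h m r + qMid coord σ h m + qBarP G coord t U μ γ σ h m r := by
  have hmh := hs.two_m_add_two_le; have hhL := hs.h_le
  have e1 : (zrange 0 h : Finset (ZMod L)) = zrange 0 (m + 1) ∪ zrange (m + 1) (h - (m + 1)) := by
    conv_lhs => rw [show h = (m + 1) + (h - (m + 1)) by omega]
    rw [zrange_add, zero_add]
  have e2 : (zrange (m + 1) (h - (m + 1)) : Finset (ZMod L)) = zrange (m + 1) (h - 2 * m - 2) ∪ zrange (h - 1 - m) (m + 1) := by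
    conv_lhs => rw [show h - (m + 1) = (h - 2 * m - 2) + (m + 1) by omega]
    rw [zrange_add, show m + 1 + (h - 2 * m - 2) = h - 1 - m by omega]
  have d1 : Disjoint (zrange 0 (m + 1) : Finset (ZMod L)) (zrange (m + 1) (h - (m + 1))) :=
    disjoint_zrange_of_le (by omega) (by omega)
  have d2 : Disjoint (zrange (m + 1) (h - 2 * m - 2) : Finset (ZMod L)) (zrange (h - 1 - m) (m + 1)) :=
    disjoint_zrange_of_le (by omega) (by omega)
  unfold qBar qBarM qMid qBarP
  rw [e1, setCharge_cslab_union d1, e2, setCharge_cslab_union d2]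
  abel

/-- `V Q_Γ Vᴴ = Q_{[1,h]}`. [folklore] -/
theorem transV_conj_setCharge_zrange (hs : 𝔖) (a n : ℕ) :
    transV f * setCharge σ (cslab coord (zrange a n)) * (transV f)ᴴ = setCharge σ (cslab coord (zrange (a + 1) n)) := by
  rw [transV, relabelOp_conj_setCharge_cslab hs.shift, image_add_one_zrange]

/-- **BBDF (4.6) conjugated**: `V Q̄ Vᴴ = Q̄₋^U + Q_m + Q̄₊^U` (exactly: `V Q_Γ Vᴴ - Q_Γ = -Q_{[0]} + Q_{[h]}`,
BBDF §3.2). [cite: BachmannEtAl2019, Eq. (4.6) and §3.2] -/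
theorem transV_conj_qBar (hs : 𝔖) : transV f * qBar G coord t U μ γ σ h r * (transV f)ᴴ =
    qBarMU G coord f t U μ γ σ h m r + qMid coord σ h m + qBarPU G coord f t U μ γ σ h m r := by
  have hmh := hs.two_m_add_two_le; have hhL := hs.h_le
  have e1 : (zrange 1 h : Finset (ZMod L)) = zrange 1 m ∪ zrange (m + 1) (h - m) := by
    conv_lhs => rw [show h = m + (h - m) by omega]
    rw [zrange_add, show 1 + m = m + 1 by omega]
  have e2 : (zrange (m + 1) (h - m) : Finset (ZMod L)) = zrange (m + 1) (h - 2 * m - 2) ∪ zrange (h - 1 - m) (m + 2) := by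
    conv_lhs => rw [show h - m = (h - 2 * m - 2) + (m + 2) by omega]
    rw [zrange_add, show m + 1 + (h - 2 * m - 2) = h - 1 - m by omega]
  have d1 : Disjoint (zrange 1 m : Finset (ZMod L)) (zrange (m + 1) (h - m)) :=
    disjoint_zrange_of_le (by omega) (by omega)
  have d2 : Disjoint (zrange (m + 1) (h - 2 * m - 2) : Finset (ZMod L)) (zrange (h - 1 - m) (m + 2)) :=
    disjoint_zrange_of_le (by omega) (by omega)
  unfold qBar qBarMU qMid qBarPU
  rw [Matrix.mul_sub, Matrix.mul_sub, Matrix.sub_mul, Matrix.sub_mul, transV_conj_setCharge_zrange hs, zero_add,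
    e1, setCharge_cslab_union d1, e2, setCharge_cslab_union d2]
  abel

/-! #### Commutation of operators on the three strips -/

/-- `[Q̄₋, Q_m] = 0`. [folklore] -/
theorem commute_qBarM_qMid (hs : 𝔖) : Commute (qBarM G coord t U μ γ σ h m r) (qMid coord σ h m) :=
  commute_of_mem_cslab (qBarM_mem hs) qMid_mem (disjoint_stripM_mid hs)

/-- `[Q̄₋, Q̄₊] = 0`. [folklore] -/
theorem commute_qBarM_qBarP (hs : 𝔖) : Commute (qBarM G coord t U μ γ σ h m r) (qBarP G coord t U μ γ σ h m r) :=
  commute_of_mem_cslab (qBarM_mem hs) (qBarP_mem hs) (disjoint_stripP_stripM hs).symm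

/-- `[Q_m, Q̄₊] = 0`. [folklore] -/
theorem commute_qMid_qBarP (hs : 𝔖) : Commute (qMid coord σ h m) (qBarP G coord t U μ γ σ h m r) :=
  commute_of_mem_cslab qMid_mem (qBarP_mem hs) (disjoint_mid_stripP hs)

/-- `[Q̄₋^U, Q_m] = 0`. [folklore] -/
theorem commute_qBarMU_qMid (hs : 𝔖) : Commute (qBarMU G coord f t U μ γ σ h m r) (qMid coord σ h m) :=
  commute_of_mem_cslab (qBarMU_mem hs) qMid_mem (disjoint_stripM_mid hs)

/-- `[Q̄₋^U, Q̄₊^U] = 0`. [folklore] -/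
theorem commute_qBarMU_qBarPU (hs : 𝔖) : Commute (qBarMU G coord f t U μ γ σ h m r) (qBarPU G coord f t U μ γ σ h m r) :=
  commute_of_mem_cslab (qBarMU_mem hs) (qBarPU_mem hs) (disjoint_stripP_stripM hs).symm

/-- `[Q_m, Q̄₊^U] = 0`. [folklore] -/
theorem commute_qMid_qBarPU (hs : 𝔖) : Commute (qMid coord σ h m) (qBarPU G coord f t U μ γ σ h m r) :=
  commute_of_mem_cslab qMid_mem (qBarPU_mem hs) (disjoint_mid_stripP hs)

/-- `[Q̄₋, Q̄₊^U] = 0`. [folklore] -/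
theorem commute_qBarM_qBarPU (hs : 𝔖) : Commute (qBarM G coord t U μ γ σ h m r) (qBarPU G coord f t U μ γ σ h m r) :=
  commute_of_mem_cslab (qBarM_mem hs) (qBarPU_mem hs) (disjoint_stripP_stripM hs).symm

/-- `[Q̄₋^U, Q̄₊] = 0`. [folklore] -/
theorem commute_qBarMU_qBarP (hs : 𝔖) : Commute (qBarMU G coord f t U μ γ σ h m r) (qBarP G coord t U μ γ σ h m r) :=
  commute_of_mem_cslab (qBarMU_mem hs) (qBarP_mem hs) (disjoint_stripP_stripM hs).symm

/-! #### Conjugating exponentials by the translation -/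

/-- **The translation conjugates exponentials**: `V e^{cX} Vᴴ = e^{c VXVᴴ}`. [folklore] -/
theorem transV_conj_exp (c : ℂ) (X : Matrix (Finset (Orb Λ)) (Finset (Orb Λ)) ℂ) :
    transV f * NormedSpace.exp (c • X) * (transV f)ᴴ = NormedSpace.exp (c • (transV f * X * (transV f)ᴴ)) := by
  unfold transV
  have hU : ((relabelOp (Orb.mapEquiv f))ᴴ)ᴴ * (relabelOp (Orb.mapEquiv f))ᴴ = 1 := by
    rw [conjTranspose_conjTranspose, relabelOp_mul_conjTranspose_self]
  have h := conjTranspose_mul_exp_mul hU (c • X)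
  rw [conjTranspose_conjTranspose] at h
  rw [h, Matrix.mul_smul, Matrix.smul_mul]

end Identities

/-! #### The two small quantities of the argument: `δ_K` and the expectation `q̄` -/

section Quantities

/-- `δ_K = ‖K₋ - K̃₋‖ + ‖K₊ - K̃₊‖`, the only "small quantity" besides clustering. [folklore] -/
def deltaK : ℝ :=
  ‖kM G coord t U μ γ σ h r - kTM G coord t U μ γ σ h‖ + ‖kP G coord t U μ γ σ h r - kTP G coord t U μ γ σ h‖

omit [NeZero L] in
/-- `δ_K ≥ 0`. [folklore] -/
theorem deltaK_nonneg : 0 ≤ deltaK G coord t U μ γ σ h r := by unfold deltaK; positivity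

/-- The real ground-state expectation `q̄ = Re ⟨ψ, Q̄ψ⟩` (`= ⟨ψ, Q̄ψ⟩`, `Q̄` Hermitian). [folklore] -/
def qbarRe (ψ : Fock (Orb Λ)) : ℝ := (star ψ ⬝ᵥ (qBar G coord t U μ γ σ h r *ᵥ ψ)).re

/-- The distance `D = min(L - h - 2m, h - 1 - 2m)` between the strips `S₋ = [-m, m]` and
`S₊ = [h-1-m, h+m]` in the coordinate direction. [folklore] -/
def stripDist (L h m : ℕ) : ℕ := min (L - h - 2 * m) (h - 1 - 2 * m)

/-- **The clustering constant of the strip pair** `(S₋, S₊)`: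
`(2 + 4J + 16J(2Δ+1)/(κ+1) + 8(κ+1)/g) (2Δ+1) max(|slab S₋|,|slab S₊|) e^{-(D-1)/max(8, 4(κ+1)/g)}`
(exponentially small in `D ≈ L/4` up to the polynomial prefactor `|Λ|`). [folklore] -/
def clustK (Δ : ℕ) (g : ℝ) : ℝ :=
  (2 + 4 * hubbardJ t U μ + 4 * (4 * hubbardJ t U μ * (2 * Δ + 1)) / ((lrRate Δ t U μ + 1) * 1) +
      8 * (lrRate Δ t U μ + 1) / g) *
    ((2 * Δ + 1) * ((max (cslab coord (zrange (L - m) (2 * m + 1))).card (cslab coord (zrange (h - 1 - m) (2 * m + 2))).card : ℕ) : ℝ)) *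
    Real.exp (-((stripDist L h m : ℕ) - (1 : ℝ)) / max (8 / 1) (4 * (lrRate Δ t U μ + 1) / g))

end Quantities

section RegimeBasics

/-! #### Elementary real-analysis helpers for the `O(L^{-k})` bookkeeping -/

omit [LinearOrder Λ] [Fintype Λ] [DecidableRel G.Adj] [NeZero L] in
/-- `e^{-x} ≤ n!/xⁿ` for `x > 0`. [folklore] -/
theorem exp_neg_le_factorial_div_pow' {x : ℝ} (hx : 0 < x) (n : ℕ) :
    Real.exp (-x) ≤ n.factorial / x ^ n := by
  have h := Real.pow_div_factorial_le_exp x hx.le n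
  rw [div_le_iff₀ (by positivity)] at h
  rw [Real.exp_neg, inv_eq_one_div, div_le_div_iff₀ (Real.exp_pos x) (pow_pos hx n), one_mul]
  linarith

omit [LinearOrder Λ] [Fintype Λ] [DecidableRel G.Adj] [NeZero L] in
/-- The numerical shape of the final error: with `X = ε/2 + δ`… precisely, for `δ, C, D ≥ 0`,
`(2π((8π·2δ + C)D) + 2√(4π·2δ + 2C) + (4π·2δ + 2C))/4 ≤ 200 (1 + D)((δ + C) + √(δ + C))`.
[folklore] -/
theorem errShape_le {δ C D : ℝ} (hδ : 0 ≤ δ) (hC : 0 ≤ C) (hD : 0 ≤ D) :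
    (2 * Real.pi * ((8 * Real.pi * (2 * δ) + C) * D) +
        (2 * Real.sqrt (4 * Real.pi * (2 * δ) + 2 * C) + (4 * Real.pi * (2 * δ) + 2 * C))) / 4 ≤
      200 * (1 + D) * ((δ + C) + Real.sqrt (δ + C)) := by
  have hπ := Real.pi_le_four
  have hπ0 := Real.pi_pos.le
  set X := δ + C with hX
  have hX0 : 0 ≤ X := by positivity
  have h1 : 2 * Real.pi * ((8 * Real.pi * (2 * δ) + C) * D) ≤ 512 * (X * D) := by
    calc 2 * Real.pi * ((8 * Real.pi * (2 * δ) + C) * D) ≤ 2 * 4 * ((8 * 4 * (2 * δ) + C) * D) := by gcongr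
      _ ≤ 512 * (X * D) := by rw [hX]; nlinarith [mul_nonneg hC hD]
  have h2 : Real.sqrt (4 * Real.pi * (2 * δ) + 2 * C) ≤ 6 * Real.sqrt X := by
    have : 4 * Real.pi * (2 * δ) + 2 * C ≤ 6 ^ 2 * X := by rw [hX]; nlinarith
    calc Real.sqrt (4 * Real.pi * (2 * δ) + 2 * C) ≤ Real.sqrt (6 ^ 2 * X) := Real.sqrt_le_sqrt this
      _ = 6 * Real.sqrt X := by rw [Real.sqrt_mul (by norm_num), Real.sqrt_sq (by norm_num)]
  have h3 : 4 * Real.pi * (2 * δ) + 2 * C ≤ 32 * X := by rw [hX]; nlinarith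
  have hsX := Real.sqrt_nonneg X
  rw [div_le_iff₀ (by norm_num : (0 : ℝ) < 4)]
  nlinarith [mul_nonneg hX0 hD, mul_nonneg hsX hD]

/-! #### The regime `h = L/2`, `m = L/8`, `r = L/16`, `L ≥ L₀`: `O(L^{-q})` bounds -/

/-- The threshold side length `L₀ = 128(⌈κ⌉₊ + 1)`, `κ` the Lieb–Robinson rate `lrRate`. [folklore] -/
def lsmL0 (Δ : ℕ) (t U μ : ℝ) : ℕ := 128 * (⌈lrRate Δ t U μ⌉₊ + 1)

omit [LinearOrder Λ] [Fintype Λ] [DecidableRel G.Adj] [NeZero L] in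
/-- `L₀ ≥ 128`. [folklore] -/
theorem le_lsmL0 (Δ : ℕ) : 128 ≤ lsmL0 Δ t U μ := by unfold lsmL0; omega

omit [LinearOrder Λ] [Fintype Λ] [DecidableRel G.Adj] [NeZero L] in
/-- `L₀ ≥ 128(κ + 1)` as reals. [folklore] -/
theorem lrRate_le_of_lsmL0_le {Δ : ℕ} (hL : lsmL0 Δ t U μ ≤ L) : 128 * (lrRate Δ t U μ + 1) ≤ (L : ℝ) := by
  have h1 : lrRate Δ t U μ ≤ ⌈lrRate Δ t U μ⌉₊ := Nat.le_ceil _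
  have h2 : ((128 * (⌈lrRate Δ t U μ⌉₊ + 1) : ℕ) : ℝ) ≤ L := by exact_mod_cast hL
  push_cast at h2
  linarith

/-- **Constructor of the setting in the regime**: with `h = L/2`, `m = L/8`, `r = L/16` and
`L ≥ L₀`, all the arithmetic side conditions of `LSMSetting` hold. [folklore] -/
theorem LSMSetting.of_regime {Δ : ℕ} {g : ℝ} {ψ : Fock (Orb Λ)} (hL : lsmL0 Δ t U μ ≤ L)
    (coordFn : IsCoordFn coord G) (shift : ∀ x, coord (f x) = coord x + 1)
    (degree : ∀ x : Λ, (Finset.univ.filter fun y => G.Adj x y).card ≤ Δ) (surj : ∀ a : ZMod L, ∃ x, coord x = a)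
    (symm : relabelOp (Orb.mapEquiv f) * hamiltonianWith G t U μ = hamiltonianWith G t U μ * relabelOp (Orb.mapEquiv f))
    (gamma_pos : 0 < γ) (gamma_le : γ ≤ g) (gap : (hamiltonianWith G t U μ).HasSpectralGap g)
    (ground : (hamiltonianWith G t U μ).IsGroundStateVector ψ) (unit : star ψ ⬝ᵥ ψ = 1) :
    LSMSetting G coord f t U μ γ (L / 2) (L / 8) (L / 16) Δ g ψ := by
  have h128 : 128 ≤ L := (le_lsmL0 t U μ Δ).trans hL
  have hκL := lrRate_le_of_lsmL0_le t U μ hL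
  have hκ := lrRate_nonneg Δ t U μ
  refine ⟨coordFn, shift, degree, surj, symm, gamma_pos, gamma_le, gap, ground, unit, by omega, by omega, by omega, by omega, ?_⟩
  -- the separation condition
  set c := ⌈lrRate Δ t U μ⌉₊ with hc
  have hLc : 128 * (c + 1) ≤ L := hL
  have hnat : 2 * c + 3 ≤ min (L - L / 2 - 2 * (L / 8)) (L / 2 - 1 - 2 * (L / 8)) := by
    refine le_min ?_ ?_ <;> omega
  have hreal : 2 * (c : ℝ) + 3 ≤ ((min (L - L / 2 - 2 * (L / 8)) (L / 2 - 1 - 2 * (L / 8)) : ℕ) : ℝ) := by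
    exact_mod_cast hnat
  have h1 : lrRate Δ t U μ ≤ c := Nat.le_ceil _
  refine max_le ?_ ?_ <;> linarith


end RegimeBasics

section Analysis

variable {G coord f t U μ γ σ h m r} {Δ : ℕ} {g : ℝ} {ψ : Fock (Orb Λ)}

local notation "𝔖" => LSMSetting G coord f t U μ γ h m r Δ g ψ

omit [NeZero L] in
/-- `Q̄` is Hermitian. [folklore] -/
theorem isHermitian_qBar : (qBar G coord t U μ γ σ h r).IsHermitian :=
  ((isHermitian_setCharge σ _).sub (isHermitian_kLoc G coord t U μ γ σ _ _ _)).sub (isHermitian_kLoc G coord t U μ γ σ _ _ _)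

local notation "QΓ" => setCharge σ (cslab coord (zrange 0 h))
local notation "QB" => qBar G coord t U μ γ σ h r
local notation "KM" => kM G coord t U μ γ σ h r
local notation "KP" => kP G coord t U μ γ σ h r
local notation "KTM" => kTM G coord t U μ γ σ h
local notation "KTP" => kTP G coord t U μ γ σ h
local notation "VV" => transV f
local notation "δK" => deltaK G coord t U μ γ σ h r

local notation "q̄" => qbarRe G coord t U μ γ σ h r ψ

omit [NeZero L] in
/-- `⟨ψ, Q̄ψ⟩ = q̄` (real). [folklore] -/
theorem expect_qBar_eq : star ψ ⬝ᵥ (QB *ᵥ ψ) = ((q̄ : ℝ) : ℂ) :=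
  expect_eq_re_of_isHermitian (isHermitian_qBar) ψ

/-- **BBDF Lemma 4.4 (variance of `Q̄`), quantitatively**: `‖(Q̄ - q̄)ψ‖₂ ≤ 2δ_K`, since `ψ` is an
EXACT eigenvector of `Q̃ = Q - K̃₋ - K̃₊` and `‖Q̄ - Q̃‖ ≤ δ_K`. [cite: BachmannEtAl2019, Lemma 4.4] -/
theorem eucNorm_qBar_sub_le (hs : 𝔖) : eucNorm (QB *ᵥ ψ - ((q̄ : ℝ) : ℂ) • ψ) ≤ 2 * δK := by
  have h2 := hs.two_m_add_two_le; have hL := hs.h_le; have hr := hs.four_le_r; have hrm := hs.r_add_two_le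
  -- the exact eigenvector property of `Q̃`
  have hex := setCharge_sub_kTilde_mulVec G coord t U μ σ (S := zrange 0 h) (disjoint_windows (L := L) (by omega) (by omega))
    (crossing_zrange_subset G coord hs.coordFn (by omega) (by omega)) hs.gamma_pos hs.gamma_le hs.gap hs.ground hs.unit
  set Qt := QΓ - KTM - KTP with hQt
  set qt : ℂ := star ψ ⬝ᵥ (Qt *ᵥ ψ) with hqt
  have hex' : Qt *ᵥ ψ = qt • ψ := hex
  -- `Q̄ - Q̃ = (K̃₋ - K₋) + (K̃₊ - K₊)`
  have hdiff : QB - Qt = (KTM - KM) + (KTP - KP) := by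
    rw [hQt, qBar, kTM, kTP]; abel
  have hnd : ‖QB - Qt‖ ≤ δK := by
    rw [hdiff, deltaK]
    refine (norm_add_le _ _).trans (add_le_add ?_ ?_) <;> rw [norm_sub_rev]
  -- decomposition of `(Q̄ - q̄)ψ`
  have hq : ((q̄ : ℝ) : ℂ) = star ψ ⬝ᵥ (QB *ᵥ ψ) := expect_qBar_eq.symm
  have hdec : QB *ᵥ ψ - ((q̄ : ℝ) : ℂ) • ψ = (QB - Qt) *ᵥ ψ + (qt - star ψ ⬝ᵥ (QB *ᵥ ψ)) • ψ := by
    rw [hq, sub_mulVec, hex', sub_smul]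
    abel
  rw [hdec]
  have h1 : eucNorm ((QB - Qt) *ᵥ ψ) ≤ δK := by
    refine (eucNorm_mulVec_le _ _).trans ?_
    rw [eucNorm_eq_one hs.unit, mul_one]; exact hnd
  have h2 : ‖qt - star ψ ⬝ᵥ (QB *ᵥ ψ)‖ ≤ δK := by
    have e : qt - star ψ ⬝ᵥ (QB *ᵥ ψ) = star ψ ⬝ᵥ ((Qt - QB) *ᵥ ψ) := by
      rw [hqt, ← dotProduct_sub, ← sub_mulVec]
    rw [e]
    refine (norm_vectorState_le hs.unit (Qt - QB)).trans ?_
    rw [norm_sub_rev]; exact hnd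
  calc eucNorm ((QB - Qt) *ᵥ ψ + (qt - star ψ ⬝ᵥ (QB *ᵥ ψ)) • ψ)
      ≤ eucNorm ((QB - Qt) *ᵥ ψ) + eucNorm ((qt - star ψ ⬝ᵥ (QB *ᵥ ψ)) • ψ) := eucNorm_add_le _ _
    _ ≤ δK + δK := by
        refine add_le_add h1 ?_
        rw [eucNorm_smul, eucNorm_eq_one hs.unit, mul_one]; exact h2
    _ = 2 * δK := by ring

local notation "CK" => clustK coord t U μ h m Δ g

/-- `clustK ≥ 0`. [folklore] -/
theorem clustK_nonneg (hs : 𝔖) : 0 ≤ CK := by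
  have hJ := hubbardJ_nonneg t U μ; have hκ := lrRate_nonneg Δ t U μ
  have hg : 0 < g := hs.gamma_pos.trans_le hs.gamma_le
  unfold clustK; positivity

/-- **Exponential clustering between the two strips** (BBDF Assumption (v) in the form used in
§4): for an even `A ∈ 𝔄⁺(slab S₋)` and `B ∈ 𝔄⁺(slab S₊)`,
`|⟨ψ,ABψ⟩ - ⟨ψ,Aψ⟩⟨ψ,Bψ⟩| ≤ clustK ‖A‖ ‖B‖`. [cite: BachmannEtAl2019, Assumption (v) and Proposition 2.4] -/
theorem strip_clustering (hs : 𝔖) {A B : Matrix (Finset (Orb Λ)) (Finset (Orb Λ)) ℂ}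
    (hA : A ∈ carEvenSubalgebra (orbSet (cslab coord (zrange (L - m) (2 * m + 1)))))
    (hB : B ∈ carEvenSubalgebra (orbSet (cslab coord (zrange (h - 1 - m) (2 * m + 2))))) :
    ‖star ψ ⬝ᵥ ((A * B) *ᵥ ψ) - (star ψ ⬝ᵥ (A *ᵥ ψ)) * (star ψ ⬝ᵥ (B *ᵥ ψ))‖ ≤ CK * ‖A‖ * ‖B‖ := by
  have hmh := hs.two_m_add_two_le; have hhL := hs.h_le
  have hg : 0 < g := hs.gamma_pos.trans_le hs.gamma_le
  have hAB : A * B = B * A := (commute_of_mem_cslab hA hB (disjoint_stripP_stripM hs).symm).eq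
  -- nonempty strips
  obtain ⟨x₀, hx₀⟩ := hs.surj (((L - m : ℕ) : ZMod L))
  obtain ⟨y₀, hy₀⟩ := hs.surj (((h - 1 - m : ℕ) : ZMod L))
  have hX : (cslab coord (zrange (L - m) (2 * m + 1))).Nonempty :=
    ⟨x₀, by rw [mem_cslab, hx₀]; exact mem_zrange.2 ⟨0, by omega, by rw [add_zero]⟩⟩
  have hY : (cslab coord (zrange (h - 1 - m) (2 * m + 2))).Nonempty :=
    ⟨y₀, by rw [mem_cslab, hy₀]; exact mem_zrange.2 ⟨0, by omega, by rw [add_zero]⟩⟩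
  have hD : ∀ x ∈ cslab coord (zrange (L - m) (2 * m + 1)), ∀ y ∈ cslab coord (zrange (h - 1 - m) (2 * m + 2)),
      stripDist L h m ≤ circDist (coord x) (coord y) := by
    intro x hx y hy
    rw [mem_cslab] at hx hy
    rw [circDist_comm]
    have := le_circDist_of_mem_zrange (a := h - 1 - m) (n := 2 * m + 2) (b := L - m) (n' := 2 * m + 1)
      (by omega) (by omega) hy hx
    refine le_trans (le_of_eq ?_) this
    unfold stripDist
    congr 1 <;> omega
  have key := coord_clustering G coord hs.coordFn hs.degree t U μ hg hs.gap hs.ground hs.unit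
    ((carEvenSubalgebra_le_carSubalgebra _) hA) ((carEvenSubalgebra_le_carSubalgebra _) hB) hAB hX hY hD hs.sep
  refine key.trans (le_of_eq ?_)
  unfold clustK
  ring

local notation "QBM" => qBarM G coord t U μ γ σ h m r
local notation "QMD" => qMid coord σ h m
local notation "QBP" => qBarP G coord t U μ γ σ h m r
local notation "QBMU" => qBarMU G coord f t U μ γ σ h m r
local notation "QBPU" => qBarPU G coord f t U μ γ σ h m r

omit [NeZero L] in
/-- `Q̄₋`, `Q̄₊`, `Q̄₋^U`, `Q̄₊^U`, `Q_m` are Hermitian. [folklore] -/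
theorem isHermitian_qBarM : (QBM).IsHermitian :=
  (isHermitian_setCharge σ _).sub (isHermitian_kLoc G coord t U μ γ σ _ _ _)

omit [NeZero L] in
/-- `Q̄₊` is Hermitian. [folklore] -/
theorem isHermitian_qBarP : (QBP).IsHermitian :=
  (isHermitian_setCharge σ _).sub (isHermitian_kLoc G coord t U μ γ σ _ _ _)

omit [NeZero L] in
/-- `Q_m` is Hermitian. [folklore] -/
theorem isHermitian_qMid : (QMD).IsHermitian := isHermitian_setCharge σ _

omit [NeZero L] in
/-- `Q̄₋^U` is Hermitian. [folklore] -/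
theorem isHermitian_qBarMU : (QBMU).IsHermitian :=
  (isHermitian_setCharge σ _).sub (Matrix.isHermitian_mul_mul_conjTranspose _ (isHermitian_kLoc G coord t U μ γ σ _ _ _))

omit [NeZero L] in
/-- `Q̄₊^U` is Hermitian. [folklore] -/
theorem isHermitian_qBarPU : (QBPU).IsHermitian :=
  (isHermitian_setCharge σ _).sub (Matrix.isHermitian_mul_mul_conjTranspose _ (isHermitian_kLoc G coord t U μ γ σ _ _ _))

/-! #### The operator `D₋ = Q̄₋^U - Q̄₋` and its expectation `-⟨Q_{[0]}⟩` -/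

local notation "DM" => (qBarMU G coord f t U μ γ σ h m r - qBarM G coord t U μ γ σ h m r)
local notation "Q₀" => setCharge σ (cslab coord (zrange 0 1))
local notation "ρ₀" => Complex.re (star ψ ⬝ᵥ (setCharge σ (cslab coord (zrange 0 1)) *ᵥ ψ))

/-- `D₋ = Q̄₋^U - Q̄₋` lies in the even CAR algebra of the strip `S₋`. [folklore] -/
theorem dM_mem (hs : 𝔖) : DM ∈ carEvenSubalgebra (orbSet (cslab coord (zrange (L - m) (2 * m + 1)))) :=
  Subalgebra.sub_mem _ (qBarMU_mem hs) (qBarM_mem hs)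

/-- `D₋ = -Q_{[0]} + (K₋ - VK₋Vᴴ)` (BBDF: `D₋ = T₋ + K₋ - U⋆K₋U`, `T₋ = -Q_{[0]}` for the translation).
[cite: BachmannEtAl2019, Eq. (4.13) and §3.2] -/
theorem dM_eq (hs : 𝔖) : DM = -Q₀ + (KM - VV * KM * VVᴴ) := by
  have hL := hs.h_le; have h2 := hs.two_m_add_two_le
  have hz : (zrange 0 (m + 1) : Finset (ZMod L)) = zrange 0 1 ∪ zrange 1 m := by
    rw [show m + 1 = 1 + m from add_comm _ _, zrange_add, zero_add]
  have hd : Disjoint (zrange 0 1 : Finset (ZMod L)) (zrange 1 m) := disjoint_zrange_of_le (by omega) (by omega)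
  unfold qBarMU qBarM
  rw [hz, setCharge_cslab_union hd]
  abel

/-- **`⟨D₋⟩ = ⟨T₋⟩ = -⟨Q_{[0]}⟩`** (BBDF (4.14): the `K`-terms cancel by the invariance of the state).
[cite: BachmannEtAl2019, Eq. (4.14)] -/
theorem expect_dM (hs : 𝔖) : star ψ ⬝ᵥ (DM *ᵥ ψ) = -(star ψ ⬝ᵥ (Q₀ *ᵥ ψ)) := by
  have hVK : star ψ ⬝ᵥ ((VV * KM * VVᴴ) *ᵥ ψ) = star ψ ⬝ᵥ (KM *ᵥ ψ) :=
    (expect_relabelOp_conj hs.gap (Orb.mapEquiv f) hs.symm hs.ground KM).1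
  rw [dM_eq hs, add_mulVec, neg_mulVec, sub_mulVec, dotProduct_add, dotProduct_neg, dotProduct_sub, hVK, sub_self,
    add_zero]

/-- Norm bound `‖D₋‖ ≤ |slab [0]| + 2‖K₋‖`. [folklore] -/
theorem norm_dM_le (hs : 𝔖) : ‖DM‖ ≤ (cslab coord (zrange 0 1)).card + 2 * ‖KM‖ := by
  rw [dM_eq hs]
  have hV : ‖VV‖ ≤ 1 := norm_le_one_of_conjTranspose_mul_self (conjTranspose_relabelOp_mul_self _)
  have hVh : ‖VVᴴ‖ ≤ 1 := by
    refine norm_le_one_of_conjTranspose_mul_self ?_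
    rw [conjTranspose_conjTranspose]; exact relabelOp_mul_conjTranspose_self _
  have hVKV : ‖VV * KM * VVᴴ‖ ≤ ‖KM‖ := by
    calc ‖VV * KM * VVᴴ‖ ≤ ‖VV‖ * ‖KM‖ * ‖VVᴴ‖ := (norm_mul_le _ _).trans (mul_le_mul_of_nonneg_right (norm_mul_le _ _) (norm_nonneg _))
      _ ≤ 1 * ‖KM‖ * 1 := by gcongr
      _ = ‖KM‖ := by ring
  calc ‖-Q₀ + (KM - VV * KM * VVᴴ)‖ ≤ ‖-Q₀‖ + ‖KM - VV * KM * VVᴴ‖ := norm_add_le _ _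
    _ ≤ (cslab coord (zrange 0 1)).card + (‖KM‖ + ‖VV * KM * VVᴴ‖) := by
        rw [norm_neg]; exact add_le_add (norm_setCharge_le σ _) (norm_sub_le _ _)
    _ ≤ (cslab coord (zrange 0 1)).card + 2 * ‖KM‖ := by linarith

/-- Norm bound `‖K₋‖ ≤ (‖W₁‖₁/γ) |slab {-1,0}| (2Δ+1) 4J`. [folklore] -/
theorem norm_kM_le (hs : 𝔖) :
    ‖KM‖ ≤ qaWeightL1 / γ * (((cslab coord (zrange (L - 1) 2)).card * (2 * Δ + 1) : ℕ) * (4 * hubbardJ t U μ)) := by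
  refine (norm_kLoc_le G coord t U μ hs.gamma_pos σ _ _ _).trans ?_
  exact mul_le_mul_of_nonneg_left (norm_windowCurrent_le G coord hs.degree t U μ σ _ _)
    (div_nonneg qaWeightL1_nonneg hs.gamma_pos.le)

/-- `V Q̄₋ Vᴴ = Q̄₋^U + Q_{[m+1]}`. [cite: BachmannEtAl2019, Eq. (4.6)] -/
theorem transV_conj_qBarM (hs : 𝔖) : VV * QBM * VVᴴ = QBMU + setCharge σ (cslab coord (zrange (m + 1) 1)) := by
  have hL := hs.h_le; have h2 := hs.two_m_add_two_le
  have hd : Disjoint (zrange 1 m : Finset (ZMod L)) (zrange (1 + m) 1) := disjoint_zrange_of_le (by omega) (by omega)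
  unfold qBarM qBarMU
  rw [Matrix.mul_sub, Matrix.sub_mul, transV_conj_setCharge_zrange hs, zero_add, zrange_add, setCharge_cslab_union hd,
    show 1 + m = m + 1 from add_comm _ _]
  abel

/-- `Q̄₋^U` commutes with `Q_{[m+1]}` (disjoint slabs). [folklore] -/
theorem commute_qBarMU_plane (hs : 𝔖) : Commute QBMU (setCharge σ (cslab coord (zrange (m + 1) 1))) := by
  have hL := hs.h_le; have h2 := hs.two_m_add_two_le
  refine commute_of_mem_cslab (qBarMU_mem hs) (setCharge_mem_carEvenSubalgebra σ _) ?_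
  rw [← zrange_add_period (m + 1) 1]
  exact disjoint_zrange_of_le (by omega) (by omega)

/-- **`V e^{2πiQ̄₋} Vᴴ = e^{2πiQ̄₋^U}` exactly** (BBDF §4.4: "`e^{2πiQ̄₋^U} = U⋆e^{2πiQ̄₋}U + O(L^{-∞})`";
here `e^{2πiQ_{[m+1]}} = 1`). [cite: BachmannEtAl2019, proof of Theorem 2.1 (§4.4)] -/
theorem transV_conj_exp_two_pi_qBarM (hs : 𝔖) :
    VV * NormedSpace.exp ((2 * Real.pi * I) • QBM) * VVᴴ = NormedSpace.exp ((2 * Real.pi * I) • QBMU) := by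
  rw [transV_conj_exp, transV_conj_qBarM hs, smul_add,
    Matrix.exp_add_of_commute _ _ (((commute_qBarMU_plane hs).smul_left _).smul_right _),
    exp_two_pi_I_smul_setCharge, Matrix.mul_one]

/-! #### The index theorem for a strict translation symmetry -/

/-- **BBDF Theorem 2.1 with Proposition 2.4 for a strict one-step translation symmetry, in
quantitative form**: in the setting `LSMSetting`, the ground-state expectation
`ρ = ⟨ψ, Q^σ_{slab [0]} ψ⟩` of the `σ`-charge of one coordinate plane satisfies
`dist(ρ, ℤ) ≤ (2π(16πδ_K + clustK)‖D₋‖ + 2√(8πδ_K + 2 clustK) + 8πδ_K + 2 clustK)/4`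
(the abstract index theorem `exists_int_abs_expect_sub_le_of_exact_symmetry` of BBDF §4 for the
exact symmetry `Vᴴ`, fed with: `ε = 2δ_K` (Lemma 4.4, `eucNorm_qBar_sub_le`), `δ = clustK`
(Assumption (v), `strip_clustering`), `e^{2πiQ_m} = 1`, `V e^{2πiQ̄₋} Vᴴ = e^{2πiQ̄₋^U}`, and
`⟨D₋⟩ = -ρ` (Eq. (4.14))). [cite: BachmannEtAl2019, Theorem 2.1, Proposition 2.4 and §4] -/
theorem exists_int_abs_expect_plane_sub_le (hs : 𝔖) :
    ∃ n : ℤ, |ρ₀ - n| ≤ (2 * Real.pi * ((8 * Real.pi * (2 * δK) + CK) * ‖DM‖) +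
        (2 * Real.sqrt (4 * Real.pi * (2 * δK) + 2 * CK) + (4 * Real.pi * (2 * δK) + 2 * CK))) / 4 := by
  have hδ := deltaK_nonneg G coord t U μ γ σ h r
  obtain ⟨lam, -, -, hVh⟩ := exists_relabelOp_mulVec_eq_smul hs.gap (Orb.mapEquiv f) hs.symm hs.ground
  have hT : (VVᴴ)ᴴ * VVᴴ = 1 := by rw [conjTranspose_conjTranspose]; exact relabelOp_mul_conjTranspose_self _
  have hTψ : VVᴴ *ᵥ ψ = lam⁻¹ • ψ := hVh
  have hSS : ∀ a ∈ carEvenSubalgebra (orbSet (cslab coord (zrange (L - m) (2 * m + 1)))),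
      ∀ b ∈ carEvenSubalgebra (orbSet (cslab coord (zrange (h - 1 - m) (2 * m + 2)))), Commute a b :=
    fun a ha b hb => commute_of_mem_cslab ha hb (disjoint_stripP_stripM hs).symm
  have hcl : ∀ a ∈ carEvenSubalgebra (orbSet (cslab coord (zrange (L - m) (2 * m + 1)))),
      ∀ b ∈ carEvenSubalgebra (orbSet (cslab coord (zrange (h - 1 - m) (2 * m + 2)))),
      ‖star ψ ⬝ᵥ ((a * b) *ᵥ ψ) - (star ψ ⬝ᵥ (a *ᵥ ψ)) * (star ψ ⬝ᵥ (b *ᵥ ψ))‖ ≤ CK * ‖a‖ * ‖b‖ :=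
    fun a ha b hb => strip_clustering hs ha hb
  have hmid_m : ∀ a ∈ carEvenSubalgebra (orbSet (cslab coord (zrange (L - m) (2 * m + 1)))), Commute QMD a :=
    fun a ha => commute_of_mem_cslab qMid_mem ha (disjoint_stripM_mid hs).symm
  have hmid_p : ∀ b ∈ carEvenSubalgebra (orbSet (cslab coord (zrange (h - 1 - m) (2 * m + 2)))), Commute QMD b :=
    fun b hb => commute_of_mem_cslab qMid_mem hb (disjoint_mid_stripP hs)
  have hQ : eucNorm ((QBM + QMD + QBP) *ᵥ ψ - ((q̄ : ℝ) : ℂ) • ψ) ≤ 2 * δK := by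
    rw [← qBar_eq hs]; exact eucNorm_qBar_sub_le hs
  have hQT : (VVᴴ)ᴴ * (QBM + QMD + QBP) * VVᴴ = QBMU + QMD + QBPU := by
    rw [conjTranspose_conjTranspose, ← qBar_eq hs]; exact transV_conj_qBar hs
  have hmid : NormedSpace.exp ((2 * Real.pi * I) • QMD) = 1 := exp_two_pi_I_smul_setCharge σ _
  have hR4 : (VVᴴ)ᴴ * NormedSpace.exp ((2 * Real.pi * I) • QBM) * VVᴴ = NormedSpace.exp ((2 * Real.pi * I) • QBMU) := by
    rw [conjTranspose_conjTranspose]; exact transV_conj_exp_two_pi_qBarM hs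
  obtain ⟨n, hn⟩ := exists_int_abs_expect_sub_le_of_exact_symmetry hs.unit hT hTψ hSS (clustK_nonneg hs) hcl
    isHermitian_qBarM isHermitian_qBarMU isHermitian_qBarP isHermitian_qBarPU isHermitian_qMid
    (qBarM_mem hs) (qBarMU_mem hs) (qBarP_mem hs) (qBarPU_mem hs) hmid_m hmid_p (by positivity : (0 : ℝ) ≤ 2 * δK)
    hQ hQT hmid hR4
  refine ⟨-n, ?_⟩
  have hre : (star ψ ⬝ᵥ ((QBMU - QBM) *ᵥ ψ)).re = -ρ₀ := by rw [expect_dM hs, Complex.neg_re]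
  rw [hre] at hn
  have e : |ρ₀ - ((-n : ℤ) : ℝ)| = |-ρ₀ - n| := by
    rw [Int.cast_neg, sub_neg_eq_add, ← abs_neg, neg_add, ← sub_eq_add_neg]
  rw [e]
  exact hn

end Analysis


/-! #### `O(L^{-q})` bounds for `δ_K`, `clustK` and `‖D₋‖` in the regime -/

section RegimeBounds

variable {G coord f t U μ γ σ} {Δ : ℕ} {g : ℝ} {ψ : Fock (Orb Λ)}

local notation "𝔖ᵣ" => LSMSetting G coord f t U μ γ (L / 2) (L / 8) (L / 16) Δ g ψ

/-- The Lieb–Robinson part of the constant of `‖K - K̃‖ ≤ dK1Const / L^q`. [folklore] -/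
def dKlrConst (Δ dd : ℕ) (t U μ γ : ℝ) (q : ℕ) : ℝ :=
  (2 * Δ + 1) * (4 * hubbardJ t U μ * (2 * Δ + 1) * 3 * hubbardJ t U μ * ((2 * Δ + 1) * (4 * hubbardJ t U μ)) *
      ((q + 3 * dd + 2).factorial * 64 ^ (q + 3 * dd + 2))) * (qaWeightL1 / γ)

/-- The filter-tail part of the constant of `‖K - K̃‖ ≤ dK1Const / L^q`. [folklore] -/
def dKtailConst (Δ dd : ℕ) (t U μ γ : ℝ) (q : ℕ) : ℝ :=
  2 * ((2 * Δ + 1) * (4 * hubbardJ t U μ)) *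
    (2 * qaTailConst (q + dd) / (γ * (γ / (64 * (lrRate Δ t U μ + 1))) ^ (q + dd + 1)))

/-- The constant of the bound `‖K - K̃‖ ≤ dK1Const / L^q` (per boundary). [folklore] -/
def dK1Const (Δ dd : ℕ) (t U μ γ : ℝ) (q : ℕ) : ℝ := dKlrConst Δ dd t U μ γ q + dKtailConst Δ dd t U μ γ q

omit [LinearOrder Λ] [Fintype Λ] [DecidableRel G.Adj] [NeZero L] in
/-- `dKtailConst ≥ 0` (for `γ > 0`). [folklore] -/
theorem dKtailConst_nonneg (Δ dd : ℕ) (hγ : 0 < γ) (q : ℕ) : 0 ≤ dKtailConst Δ dd t U μ γ q := by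
  have := hubbardJ_nonneg t U μ; have := lrRate_nonneg Δ t U μ; have := (qaTailConst_pos (q + dd)).le
  unfold dKtailConst; positivity

omit [LinearOrder Λ] [Fintype Λ] [DecidableRel G.Adj] [NeZero L] in
/-- `dKlrConst ≥ 0` (for `γ > 0`). [folklore] -/
theorem dKlrConst_nonneg (Δ dd : ℕ) (hγ : 0 < γ) (q : ℕ) : 0 ≤ dKlrConst Δ dd t U μ γ q := by
  have := hubbardJ_nonneg t U μ; have := qaWeightL1_nonneg
  unfold dKlrConst; positivity

/-- **`‖K - K̃‖ = O(L^{-q})` in the regime** (per boundary window `P` with its ball `B`):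
Lieb–Robinson part `O(L^{3d+2} e^{-L/64})` plus filter-tail part `O(L^{d-(q+d+1)})`.
[cite: BachmannEtAl2019, Proposition 2.4 (proof: `K̃_± = K_± + O(L^{-∞})`)] -/
theorem norm_kLoc_sub_kTilde_le_of_regime (hs : 𝔖ᵣ) (hL : lsmL0 Δ t U μ ≤ L) {P B : Finset (ZMod L)}
    (hPne : (cslab coord P).Nonempty)
    (hsep : ∀ Z : HubbardIdx G, ¬ hubbardTermSupp G Z ⊆ cslab coord B →
      ∀ z ∈ hubbardTermSupp G Z, ∀ p ∈ cslab coord P, L / 16 - 1 ≤ circDist (coord z) (coord p))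
    {dd : ℕ} (hN : Fintype.card Λ ≤ L ^ dd) (q : ℕ) :
    ‖kLoc G coord t U μ γ σ (zrange 0 (L / 2)) P B - kTilde G coord t U μ γ σ (zrange 0 (L / 2)) P‖ ≤
      dK1Const Δ dd t U μ γ q / (L : ℝ) ^ q := by
  have h128 : 128 ≤ L := (le_lsmL0 t U μ Δ).trans hL
  have hκ := lrRate_nonneg Δ t U μ
  have hJ := hubbardJ_nonneg t U μ
  have hγ := hs.gamma_pos
  have hW := qaWeightL1_nonneg
  have hCt := (qaTailConst_pos (q + dd)).le
  have hLpos : (0 : ℝ) < L := by exact_mod_cast (show 0 < L by omega)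
  have hL1 : (1 : ℝ) ≤ L := by exact_mod_cast (show 1 ≤ L by omega)
  -- the radius `r = L/16` and the time `T`
  have hr_real : (L : ℝ) / 32 ≤ ((L / 16 : ℕ) : ℝ) - 2 := by
    have h1 : L ≤ 32 * (L / 16 - 2) := by omega
    have h2 : ((L : ℕ) : ℝ) ≤ ((32 * (L / 16 - 2) : ℕ) : ℝ) := by exact_mod_cast h1
    have h3 : ((L / 16 - 2 : ℕ) : ℝ) = ((L / 16 : ℕ) : ℝ) - 2 := by
      rw [Nat.cast_sub (by omega)]; norm_num
    rw [Nat.cast_mul, h3] at h2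
    push_cast at h2
    linarith
  have hR : (((L / 16 - 1 : ℕ) : ℝ) - 1) = ((L / 16 : ℕ) : ℝ) - 2 := by
    rw [Nat.cast_sub (by omega)]; push_cast; ring
  set T : ℝ := (((L / 16 : ℕ) : ℝ) - 2) / (2 * (lrRate Δ t U μ + 1)) with hTdef
  have hT0 : 0 ≤ T := div_nonneg (by linarith [show (0:ℝ) ≤ (L:ℝ) / 32 by positivity]) (by positivity)
  have hTL : T ≤ L := by
    rw [hTdef, div_le_iff₀ (by positivity)]
    have : ((L / 16 : ℕ) : ℝ) ≤ L := by exact_mod_cast Nat.div_le_self L 16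
    nlinarith
  have hκT : (lrRate Δ t U μ + 1) * T = (((L / 16 : ℕ) : ℝ) - 2) / 2 := by
    rw [hTdef]; field_simp
  have hTlow : (L : ℝ) * (γ / (64 * (lrRate Δ t U μ + 1))) ≤ γ * T := by
    have : (L : ℝ) * (γ / (64 * (lrRate Δ t U μ + 1))) = γ * (((L : ℝ) / 32) / (2 * (lrRate Δ t U μ + 1))) := by
      field_simp; ring
    rw [this, hTdef]
    exact mul_le_mul_of_nonneg_left (div_le_div_of_nonneg_right hr_real (by positivity)) hγ.le
  -- the abstract bound
  have key := norm_kLoc_sub_kTilde_le G coord hs.coordFn hs.degree t U μ hγ σ (S := zrange 0 (L / 2)) hPne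
    (R := L / 16 - 1) (by omega) hsep hT0 (q + dd)
  rw [hR] at key
  refine key.trans ?_
  -- atom bounds
  have hNreal : (Fintype.card Λ : ℝ) ≤ (L : ℝ) ^ dd := by exact_mod_cast hN
  have hPcard : ((cslab coord P).card : ℝ) ≤ (L : ℝ) ^ dd :=
    le_trans (by exact_mod_cast Finset.card_le_univ _) hNreal
  have hLdd1 : (1 : ℝ) ≤ (L : ℝ) ^ dd := one_le_pow₀ hL1
  have a1 : ((Fintype.card Λ * (2 * Δ + 1) : ℕ) : ℝ) ≤ (L : ℝ) ^ dd * (2 * Δ + 1) := by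
    push_cast; exact mul_le_mul_of_nonneg_right hNreal (by positivity)
  have a2 : ((max 2 (cslab coord P).card : ℕ) : ℝ) ≤ 3 * (L : ℝ) ^ dd := by
    push_cast
    exact max_le (by linarith) (by linarith)
  have a3 : ‖windowCurrent G coord t U μ σ (zrange 0 (L / 2)) P‖ ≤ (L : ℝ) ^ dd * (2 * Δ + 1) * (4 * hubbardJ t U μ) := by
    refine (norm_windowCurrent_le G coord hs.degree t U μ σ _ P).trans ?_
    push_cast
    exact mul_le_mul_of_nonneg_right (mul_le_mul_of_nonneg_right hPcard (by positivity)) (by positivity)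
  have a4 : Real.exp (lrRate Δ t U μ * T - (((L / 16 : ℕ) : ℝ) - 2)) ≤
      ((q + 3 * dd + 2).factorial * 64 ^ (q + 3 * dd + 2)) / (L : ℝ) ^ (q + 3 * dd + 2) := by
    have e1 : lrRate Δ t U μ * T - (((L / 16 : ℕ) : ℝ) - 2) ≤ -((L : ℝ) / 64) := by
      have : lrRate Δ t U μ * T ≤ (lrRate Δ t U μ + 1) * T := mul_le_mul_of_nonneg_right (by linarith) hT0
      linarith
    refine (Real.exp_le_exp.2 e1).trans
      ((exp_neg_le_factorial_div_pow' (x := (L : ℝ) / 64) (by positivity) (q + 3 * dd + 2)).trans (le_of_eq ?_))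
    rw [div_pow, div_div_eq_mul_div]
  have a5 : ((L : ℝ) * (γ / (64 * (lrRate Δ t U μ + 1)))) ^ (q + dd + 1) ≤ (1 + γ * T) ^ (q + dd + 1) :=
    pow_le_pow_left₀ (by positivity) (hTlow.trans (by linarith)) _
  -- power counting
  have hX : ((L : ℝ) ^ dd) ^ 3 * (L : ℝ) ^ 2 * (1 / (L : ℝ) ^ (q + 3 * dd + 2)) = 1 / (L : ℝ) ^ q := by
    rw [mul_one_div, div_eq_div_iff (by positivity) (by positivity), one_mul, ← pow_mul, ← pow_add, ← pow_add]
    congr 1; ring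
  have hY : (L : ℝ) ^ dd * (1 / (L : ℝ) ^ (q + dd + 1)) ≤ 1 / (L : ℝ) ^ q := by
    rw [mul_one_div, div_le_div_iff₀ (by positivity) (by positivity), one_mul, ← pow_add]
    exact pow_le_pow_right₀ hL1 (by omega)
  have hA0 := dKlrConst_nonneg (t := t) (U := U) (μ := μ) Δ dd hγ q
  have hB0 := dKtailConst_nonneg (t := t) (U := U) (μ := μ) Δ dd hγ q
  calc ((Fintype.card Λ * (2 * Δ + 1) : ℕ) : ℝ) * (4 * hubbardJ t U μ * (2 * Δ + 1) *
          ((max 2 (cslab coord P).card : ℕ) : ℝ) * hubbardJ t U μ * ‖windowCurrent G coord t U μ σ (zrange 0 (L / 2)) P‖ *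
          T * Real.exp (lrRate Δ t U μ * T - (((L / 16 : ℕ) : ℝ) - 2))) * T * (qaWeightL1 / γ) +
      2 * ‖windowCurrent G coord t U μ σ (zrange 0 (L / 2)) P‖ * (2 * qaTailConst (q + dd) / (γ * (1 + γ * T) ^ (q + dd + 1)))
      ≤ ((L : ℝ) ^ dd * (2 * Δ + 1)) * (4 * hubbardJ t U μ * (2 * Δ + 1) * (3 * (L : ℝ) ^ dd) *
          hubbardJ t U μ * ((L : ℝ) ^ dd * (2 * Δ + 1) * (4 * hubbardJ t U μ)) * L *
            (((q + 3 * dd + 2).factorial * 64 ^ (q + 3 * dd + 2)) / (L : ℝ) ^ (q + 3 * dd + 2))) *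
        L * (qaWeightL1 / γ) +
      2 * ((L : ℝ) ^ dd * (2 * Δ + 1) * (4 * hubbardJ t U μ)) *
        (2 * qaTailConst (q + dd) / (γ * ((L : ℝ) * (γ / (64 * (lrRate Δ t U μ + 1)))) ^ (q + dd + 1))) := by
        gcongr
    _ = dKlrConst Δ dd t U μ γ q * (((L : ℝ) ^ dd) ^ 3 * (L : ℝ) ^ 2 * (1 / (L : ℝ) ^ (q + 3 * dd + 2))) +
        dKtailConst Δ dd t U μ γ q * ((L : ℝ) ^ dd * (1 / (L : ℝ) ^ (q + dd + 1))) := by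
        unfold dKlrConst dKtailConst
        rw [mul_pow]
        ring
    _ ≤ dKlrConst Δ dd t U μ γ q * (1 / (L : ℝ) ^ q) + dKtailConst Δ dd t U μ γ q * (1 / (L : ℝ) ^ q) := by
        rw [hX]
        exact add_le_add_right (mul_le_mul_of_nonneg_left hY hB0) _
    _ = dK1Const Δ dd t U μ γ q / (L : ℝ) ^ q := by unfold dK1Const; ring


/-- **`δ_K = O(L^{-q})` in the regime** (both boundaries). [cite: BachmannEtAl2019, Proposition 2.4] -/
theorem deltaK_le_of_regime (hs : 𝔖ᵣ) (hL : lsmL0 Δ t U μ ≤ L) {dd : ℕ} (hN : Fintype.card Λ ≤ L ^ dd) (q : ℕ) :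
    deltaK G coord t U μ γ σ (L / 2) (L / 16) ≤ 2 * dK1Const Δ dd t U μ γ q / (L : ℝ) ^ q := by
  have h128 : 128 ≤ L := (le_lsmL0 t U μ Δ).trans hL
  obtain ⟨x₀, hx₀⟩ := hs.surj (((L - 1 : ℕ) : ZMod L))
  obtain ⟨y₀, hy₀⟩ := hs.surj (((L / 2 - 1 : ℕ) : ZMod L))
  have hPM : (cslab coord (zrange (L - 1) 2)).Nonempty :=
    ⟨x₀, by rw [mem_cslab, hx₀]; exact mem_zrange.2 ⟨0, by omega, by rw [add_zero]⟩⟩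
  have hPP : (cslab coord (zrange (L / 2 - 1) 2)).Nonempty :=
    ⟨y₀, by rw [mem_cslab, hy₀]; exact mem_zrange.2 ⟨0, by omega, by rw [add_zero]⟩⟩
  have hM := norm_kLoc_sub_kTilde_le_of_regime (σ := σ) hs hL hPM
    (ballM_separation (r := L / 16) hs.coordFn (by omega) (by omega)) hN q
  have hP := norm_kLoc_sub_kTilde_le_of_regime (σ := σ) hs hL hPP
    (ballP_separation (r := L / 16) (h := L / 2) hs.coordFn (by omega) (by omega) (by omega)) hN q
  have e2 : 2 * dK1Const Δ dd t U μ γ q / (L : ℝ) ^ q = dK1Const Δ dd t U μ γ q / (L : ℝ) ^ q + dK1Const Δ dd t U μ γ q / (L : ℝ) ^ q := by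
    ring
  rw [e2]
  exact add_le_add hM hP

/-- The constant of the bound `clustK ≤ clustKConst / L^q`. [folklore] -/
def clustKConst (Δ dd : ℕ) (t U μ g : ℝ) (q : ℕ) : ℝ :=
  (2 + 4 * hubbardJ t U μ + 4 * (4 * hubbardJ t U μ * (2 * Δ + 1)) / ((lrRate Δ t U μ + 1) * 1) +
      8 * (lrRate Δ t U μ + 1) / g) * (2 * Δ + 1) *
    ((q + dd).factorial * (8 * max (8 / 1) (4 * (lrRate Δ t U μ + 1) / g)) ^ (q + dd))

omit [LinearOrder Λ] [Fintype Λ] [DecidableRel G.Adj] [NeZero L] in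
/-- `clustKConst ≥ 0` (for `g > 0`). [folklore] -/
theorem clustKConst_nonneg (Δ dd : ℕ) (hg : 0 < g) (q : ℕ) : 0 ≤ clustKConst Δ dd t U μ g q := by
  have := hubbardJ_nonneg t U μ; have := lrRate_nonneg Δ t U μ
  unfold clustKConst; positivity

/-- **`clustK = O(L^{-q})` in the regime** (the strips are `≥ L/4 - 1` apart).
[cite: BachmannEtAl2019, Proposition 2.4 (Assumption (v))] -/
theorem clustK_le_of_regime (hs : 𝔖ᵣ) (hL : lsmL0 Δ t U μ ≤ L) {dd : ℕ} (hN : Fintype.card Λ ≤ L ^ dd) (q : ℕ) :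
    clustK coord t U μ (L / 2) (L / 8) Δ g ≤ clustKConst Δ dd t U μ g q / (L : ℝ) ^ q := by
  have h128 : 128 ≤ L := (le_lsmL0 t U μ Δ).trans hL
  have hκ := lrRate_nonneg Δ t U μ
  have hJ := hubbardJ_nonneg t U μ
  have hg : 0 < g := hs.gamma_pos.trans_le hs.gamma_le
  have hLpos : (0 : ℝ) < L := by exact_mod_cast (show 0 < L by omega)
  have hL1 : (1 : ℝ) ≤ L := by exact_mod_cast (show 1 ≤ L by omega)
  have hNreal : (Fintype.card Λ : ℝ) ≤ (L : ℝ) ^ dd := by exact_mod_cast hN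
  set c₁ : ℝ := max (8 / 1) (4 * (lrRate Δ t U μ + 1) / g) with hc₁
  have hc₁8 : 8 ≤ c₁ := by rw [hc₁]; exact le_max_of_le_left (by norm_num)
  have hc₁0 : 0 < c₁ := by linarith
  -- the distance between the strips
  have hD : (L : ℝ) / 8 ≤ ((stripDist L (L / 2) (L / 8) : ℕ) : ℝ) - 1 := by
    have h1 : L ≤ 8 * (stripDist L (L / 2) (L / 8) - 1) := by unfold stripDist; omega
    have h1' : 1 ≤ stripDist L (L / 2) (L / 8) := by unfold stripDist; omega
    have h2 : ((L : ℕ) : ℝ) ≤ ((8 * (stripDist L (L / 2) (L / 8) - 1) : ℕ) : ℝ) := by exact_mod_cast h1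
    rw [Nat.cast_mul, Nat.cast_sub h1'] at h2
    push_cast at h2
    linarith
  have a6 : ((max (cslab coord (zrange (L - L / 8) (2 * (L / 8) + 1))).card
      (cslab coord (zrange (L / 2 - 1 - L / 8) (2 * (L / 8) + 2))).card : ℕ) : ℝ) ≤ (L : ℝ) ^ dd := by
    have : max (cslab coord (zrange (L - L / 8) (2 * (L / 8) + 1))).card
        (cslab coord (zrange (L / 2 - 1 - L / 8) (2 * (L / 8) + 2))).card ≤ Fintype.card Λ :=
      max_le (Finset.card_le_univ _) (Finset.card_le_univ _)
    exact le_trans (by exact_mod_cast this) hNreal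
  have a7 : Real.exp (-(((stripDist L (L / 2) (L / 8) : ℕ) : ℝ) - (1 : ℝ)) / c₁) ≤
      ((q + dd).factorial * (8 * c₁) ^ (q + dd)) / (L : ℝ) ^ (q + dd) := by
    have e1 : -(((stripDist L (L / 2) (L / 8) : ℕ) : ℝ) - (1 : ℝ)) / c₁ ≤ -((L : ℝ) / (8 * c₁)) := by
      rw [neg_div, neg_le_neg_iff, div_le_div_iff₀ (by positivity) hc₁0]
      nlinarith
    refine (Real.exp_le_exp.2 e1).trans
      ((exp_neg_le_factorial_div_pow' (x := (L : ℝ) / (8 * c₁)) (by positivity) (q + dd)).trans (le_of_eq ?_))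
    rw [div_pow, div_div_eq_mul_div]
  have hpref : 0 ≤ (2 + 4 * hubbardJ t U μ + 4 * (4 * hubbardJ t U μ * (2 * Δ + 1)) / ((lrRate Δ t U μ + 1) * 1) +
      8 * (lrRate Δ t U μ + 1) / g) := by positivity
  unfold clustK
  calc (2 + 4 * hubbardJ t U μ + 4 * (4 * hubbardJ t U μ * (2 * Δ + 1)) / ((lrRate Δ t U μ + 1) * 1) +
          8 * (lrRate Δ t U μ + 1) / g) *
        ((2 * Δ + 1) * ((max (cslab coord (zrange (L - L / 8) (2 * (L / 8) + 1))).card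
          (cslab coord (zrange (L / 2 - 1 - L / 8) (2 * (L / 8) + 2))).card : ℕ) : ℝ)) *
        Real.exp (-(((stripDist L (L / 2) (L / 8) : ℕ) : ℝ) - (1 : ℝ)) / c₁)
      ≤ (2 + 4 * hubbardJ t U μ + 4 * (4 * hubbardJ t U μ * (2 * Δ + 1)) / ((lrRate Δ t U μ + 1) * 1) +
          8 * (lrRate Δ t U μ + 1) / g) * ((2 * Δ + 1) * (L : ℝ) ^ dd) *
        (((q + dd).factorial * (8 * c₁) ^ (q + dd)) / (L : ℝ) ^ (q + dd)) := by gcongr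
    _ = clustKConst Δ dd t U μ g q * ((L : ℝ) ^ dd / (L : ℝ) ^ (q + dd)) := by
        unfold clustKConst; rw [hc₁]; ring
    _ = clustKConst Δ dd t U μ g q / (L : ℝ) ^ q := by
        rw [pow_add, mul_comm ((L : ℝ) ^ q), ← div_div, div_self (by positivity), mul_one_div]

/-- The constant of the bound `‖D₋‖ ≤ dmConst · L^d`. [folklore] -/
def dmConst (Δ : ℕ) (t U μ γ : ℝ) : ℝ := 1 + 2 * (qaWeightL1 / γ * ((2 * Δ + 1) * (4 * hubbardJ t U μ)))

omit [LinearOrder Λ] [Fintype Λ] [DecidableRel G.Adj] [NeZero L] in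
/-- `dmConst ≥ 1` (for `γ > 0`). [folklore] -/
theorem one_le_dmConst (Δ : ℕ) (hγ : 0 < γ) : 1 ≤ dmConst Δ t U μ γ := by
  have := hubbardJ_nonneg t U μ; have := qaWeightL1_nonneg
  unfold dmConst
  have : 0 ≤ 2 * (qaWeightL1 / γ * ((2 * Δ + 1) * (4 * hubbardJ t U μ))) := by positivity
  linarith

/-- **`‖D₋‖ = O(L^d)`**: `‖Q̄₋^U - Q̄₋‖ ≤ dmConst · L^d`. [folklore] -/
theorem norm_dM_le_of_regime (hs : 𝔖ᵣ) {dd : ℕ} (hN : Fintype.card Λ ≤ L ^ dd) :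
    ‖qBarMU G coord f t U μ γ σ (L / 2) (L / 8) (L / 16) - qBarM G coord t U μ γ σ (L / 2) (L / 8) (L / 16)‖ ≤
      dmConst Δ t U μ γ * (L : ℝ) ^ dd := by
  have hJ := hubbardJ_nonneg t U μ; have hW := qaWeightL1_nonneg; have hγ := hs.gamma_pos
  have hNreal : (Fintype.card Λ : ℝ) ≤ (L : ℝ) ^ dd := by exact_mod_cast hN
  have c1 : ((cslab coord (zrange 0 1)).card : ℝ) ≤ (L : ℝ) ^ dd :=
    le_trans (by exact_mod_cast Finset.card_le_univ _) hNreal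
  have c2 : (((cslab coord (zrange (L - 1) 2)).card * (2 * Δ + 1) : ℕ) : ℝ) ≤ (L : ℝ) ^ dd * (2 * Δ + 1) := by
    push_cast
    exact mul_le_mul_of_nonneg_right (le_trans (by exact_mod_cast Finset.card_le_univ _) hNreal) (by positivity)
  have h1 := norm_dM_le (σ := σ) hs
  have h2 := norm_kM_le (σ := σ) hs
  calc ‖qBarMU G coord f t U μ γ σ (L / 2) (L / 8) (L / 16) - qBarM G coord t U μ γ σ (L / 2) (L / 8) (L / 16)‖
      ≤ (cslab coord (zrange 0 1)).card + 2 * (qaWeightL1 / γ *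
          ((((cslab coord (zrange (L - 1) 2)).card * (2 * Δ + 1) : ℕ) : ℝ) * (4 * hubbardJ t U μ))) :=
        h1.trans (by linarith)
    _ ≤ (L : ℝ) ^ dd + 2 * (qaWeightL1 / γ * (((L : ℝ) ^ dd * (2 * Δ + 1)) * (4 * hubbardJ t U μ))) := by gcongr
    _ = dmConst Δ t U μ γ * (L : ℝ) ^ dd := by unfold dmConst; ring

/-- The constant of the final index bound `dist(ρ, ℤ) ≤ lsmConst / L^k`. [folklore] -/
def lsmConst (Δ dd : ℕ) (t U μ γ g : ℝ) (k : ℕ) : ℝ :=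
  400 * dmConst Δ t U μ γ *
    ((2 * dK1Const Δ dd t U μ γ (2 * k + 2 * dd) + clustKConst Δ dd t U μ g (2 * k + 2 * dd)) +
      Real.sqrt (2 * dK1Const Δ dd t U μ γ (2 * k + 2 * dd) + clustKConst Δ dd t U μ g (2 * k + 2 * dd)))

/-- **The index theorem in the regime, `O(L^{-k})` form**: for `h = L/2`, `m = L/8`, `r = L/16`,
`L ≥ L₀` and `|Λ| ≤ L^d`, the charge of one coordinate plane in the ground state is within
`lsmConst / L^k` of an integer (BBDF Theorem 2.1 with Proposition 2.4: "`⟨Ω, T₋Ω⟩ ∈ ℤ + O(L^{-∞})`").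
[cite: BachmannEtAl2019, Theorem 2.1 and Proposition 2.4] -/
theorem exists_int_abs_expect_plane_sub_le_of_regime (hs : 𝔖ᵣ) (hL : lsmL0 Δ t U μ ≤ L) {dd : ℕ}
    (hN : Fintype.card Λ ≤ L ^ dd) (k : ℕ) :
    ∃ n : ℤ, |Complex.re (star ψ ⬝ᵥ (setCharge σ (cslab coord (zrange 0 1)) *ᵥ ψ)) - n| ≤
      lsmConst Δ dd t U μ γ g k / (L : ℝ) ^ k := by
  have h128 : 128 ≤ L := (le_lsmL0 t U μ Δ).trans hL
  have hLpos : (0 : ℝ) < L := by exact_mod_cast (show 0 < L by omega)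
  have hL1 : (1 : ℝ) ≤ L := by exact_mod_cast (show 1 ≤ L by omega)
  have hγ := hs.gamma_pos
  have hδ := deltaK_nonneg G coord t U μ γ σ (L / 2) (L / 16)
  have hCK := clustK_nonneg hs
  obtain ⟨n, hn⟩ := exists_int_abs_expect_plane_sub_le (σ := σ) hs
  refine ⟨n, hn.trans ((errShape_le hδ hCK (norm_nonneg _)).trans ?_)⟩
  -- the small quantity `X = δ_K + clustK ≤ B / L^q`, `q = 2k + 2d`
  set B : ℝ := 2 * dK1Const Δ dd t U μ γ (2 * k + 2 * dd) + clustKConst Δ dd t U μ g (2 * k + 2 * dd) with hB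
  have hX : deltaK G coord t U μ γ σ (L / 2) (L / 16) + clustK coord t U μ (L / 2) (L / 8) Δ g ≤
      B / (L : ℝ) ^ (2 * k + 2 * dd) := by
    rw [hB, add_div]
    exact add_le_add (deltaK_le_of_regime hs hL hN _) (clustK_le_of_regime hs hL hN _)
  have hg : 0 < g := hs.gamma_pos.trans_le hs.gamma_le
  have hB0 : 0 ≤ B := by
    have h1 := dKlrConst_nonneg (t := t) (U := U) (μ := μ) Δ dd hγ (2 * k + 2 * dd)
    have h2 := dKtailConst_nonneg (t := t) (U := U) (μ := μ) Δ dd hγ (2 * k + 2 * dd)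
    have h3 := clustKConst_nonneg (t := t) (U := U) (μ := μ) Δ dd hg (2 * k + 2 * dd)
    rw [hB, dK1Const]; positivity
  have hLq : (L : ℝ) ^ (2 * k + 2 * dd) = ((L : ℝ) ^ (k + dd)) ^ 2 := by rw [← pow_mul]; congr 1; ring
  have hsqrt : Real.sqrt (B / (L : ℝ) ^ (2 * k + 2 * dd)) = Real.sqrt B / (L : ℝ) ^ (k + dd) := by
    rw [Real.sqrt_div hB0, hLq, Real.sqrt_sq (by positivity)]
  have hBq : B / (L : ℝ) ^ (2 * k + 2 * dd) ≤ B / (L : ℝ) ^ (k + dd) :=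
    div_le_div_of_nonneg_left hB0 (by positivity) (pow_le_pow_right₀ hL1 (by omega))
  -- `1 + ‖D₋‖ ≤ 2 dmConst L^d`
  have hD := norm_dM_le_of_regime (σ := σ) hs hN
  have hdm := one_le_dmConst (t := t) (U := U) (μ := μ) Δ hγ
  have hLdd1 : (1 : ℝ) ≤ (L : ℝ) ^ dd := one_le_pow₀ hL1
  have hD' : 1 + ‖qBarMU G coord f t U μ γ σ (L / 2) (L / 8) (L / 16) - qBarM G coord t U μ γ σ (L / 2) (L / 8) (L / 16)‖ ≤
      2 * (dmConst Δ t U μ γ * (L : ℝ) ^ dd) := by nlinarith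
  -- monotonicity of `X ↦ X + √X`
  set X := deltaK G coord t U μ γ σ (L / 2) (L / 16) + clustK coord t U μ (L / 2) (L / 8) Δ g with hXdef
  have hX0 : 0 ≤ X := by positivity
  calc 200 * (1 + ‖qBarMU G coord f t U μ γ σ (L / 2) (L / 8) (L / 16) - qBarM G coord t U μ γ σ (L / 2) (L / 8) (L / 16)‖) *
        (X + Real.sqrt X)
      ≤ 200 * (2 * (dmConst Δ t U μ γ * (L : ℝ) ^ dd)) *
        (B / (L : ℝ) ^ (k + dd) + Real.sqrt B / (L : ℝ) ^ (k + dd)) := by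
        gcongr 200 * ?_ * (?_ + ?_)
        · exact hX.trans hBq
        · rw [← hsqrt]; exact Real.sqrt_le_sqrt hX
    _ = lsmConst Δ dd t U μ γ g k / (L : ℝ) ^ k := by
        unfold lsmConst; rw [← hB, pow_add]; field_simp; ring

end RegimeBounds

end IndexSetting

end Literature.MathematicalPhysics.QuantumLattice

end
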